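import Literature.NumberTheory.LFunctions.ZeroDensityGuthMaynardWindow
import HarnessLib

/-!
# Guth–Maynard's Theorem 1.1 from their Proposition 3.1 (the reduction of §3)

Topic `NumberTheory/LFunctions`, family RH; a leaf above `ZeroDensityGuthMaynardWindow.lean`.
That file reduces the tree's named fact `Literature.NumberTheory.LFunctions.zeroDensity_guth_maynard`
(Guth–Maynard, Theorem 1.2: `N(σ, T) ≪_ε T^{15(1−σ)/(3+5σ)+ε}`, `7/10 ≤ σ ≤ 1`) to the large values
estimate of their Theorem 1.1. This file PROVES §3 of the paper ("Reduction to Main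
Proposition": Theorem 1.1 from Proposition 3.1) and so reduces the fact one step further, to
Proposition 3.1 alone:

* `GuthMaynardReduction.largeValues_of_keyProp (hw) (hKP)` — Theorem 1.1 (in the form `hLV`
  consumed by `zeroDensity_guth_maynard_of_largeValues`) from Proposition 3.1;
* `zeroDensity_guth_maynard_of_keyProp (hw) (hKP) : zeroDensity_guth_maynard`.

Here `w : ℝ → ℝ` is any weight equal to `1` on `[6/5, 9/5]` (the paper fixes a smooth bump
supported on `[1, 2]`; only `w = 1` on `[6/5, 9/5]` is used in §3, smoothness being needed for
Proposition 3.1 itself), and `hKP` is Proposition 3.1 as printed: "Let `σ ∈ [7/10, 8/10]` and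
`ε > 0`. Let `b_n` be a sequence of complex numbers with `|b_n| ≤ 1` and `W` be a set of
`T^ε`-separated points in an interval of length `T = N^{6/5}` such that
`|∑_n w(n/N) b_n n^{it}| ≥ N^σ` for all `t ∈ W`. Then `|W| ≤ T N^{(12−20σ)/5+o_ε(1)}`", the
`o_ε(1)` read as "for every `δ > 0`, for `N ≥ N₀(σ, ε, δ)`, with a constant `C(σ, ε, δ)`". No
definition and no named fact is introduced; everything in this file is proved. Proposition 3.1
(§§4–12 of the paper) is not in the tree.

## The argument (Guth–Maynard §3) and the deviations from it

Given `ε`, `T` large, `1 ≤ N ≤ T`, `|b_n| ≤ 1`, a `1`-separated `W ⊂ [0, T]` on which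
`|∑_{N≤n≤2N} b_n n^{it}| ≥ V`:
* `V ≤ 4N^{7/10}` or `V ≥ N^{4/5}`: the classical estimate (1.1) of the paper,
  `R ≲ N²V⁻² + T min(NV⁻², N⁴V⁻⁶)`, here assembled from the tree's discrete mean value theorem
  (`Gallagher.discreteMeanValue`: `GuthMaynardReduction.largeValues_mvt`) and Huxley's large
  values theorem (27.27) (`Huxley1972_largeValues_holds`, at the points `it` after thinning to a
  `log 2N`-separated set: `GuthMaynardReduction.largeValues_hmh`); `TNV⁻² ≤ 16 TN^{12/5}V⁻⁴` in
  the first case and `TN⁴V⁻⁶ ≤ TN^{12/5}V⁻⁴` in the second (`largeValues_smallV`,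
  `largeValues_largeV`). (The paper's further reduction to `N < T` is not needed: the form `hLV`
  only asks for `N ≤ T`.)
* `4N^{7/10} < V < N^{4/5}`: split `[N, 2N]` into the pieces `5n < 6N`, `6N ≤ 5n ≤ 9N`, `9N < 5n`
  (`norm_sum_Icc_le_three_pieces`); each lies in `[6N'/5, 9N'/5]` for `N' = ⌊5N/6⌋, N, ⌈10N/9⌉`,
  so `w(n/N')` may be inserted (`sum_weight_indicator_eq`); write `V/3 = N'^{σ*}` and choose a
  grid point `σ' = 7/10 + jΔ ≤ σ* < σ' + Δ` (`sigma_grid` — the deviation from the paper that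
  makes the constants of Proposition 3.1, quantified per `σ`, uniform: only the finitely many
  `σ_j` are used, at the cost `N'^{4Δ}`); thin `W` to `T^η`-separated classes
  (`card_le_of_thinning_real`, the paper's `W'`), subdivide `[0, T]` into intervals of length
  `N'^{6/5}` (`card_le_of_subdivision`) and apply Proposition 3.1 on each (`piece_bound`):
  `#W ≲ T^η (T + N'^{6/5}) N'^{(12−20σ')/5+δ} ≲ T^{η+4Δ+δ}(TN^{12/5} + N^{18/5})V⁻⁴`.
  Small `N` are absorbed into the constant (`card_le_of_one_sep`).

## Main statements (all proved)

* `GuthMaynardReduction.largeValues_mvt`, `GuthMaynardReduction.largeValues_hmh` — the classical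
  large values estimates on `1`-separated real points.
* `GuthMaynardReduction.card_le_of_one_sep`, `card_le_of_thinning_real`, `card_le_of_subdivision`,
  `card_le_of_sep_of_short` — counting, thinning, subdivision.
* `GuthMaynardReduction.sigma_grid`, `GuthMaynardReduction.piece_bound` — the bound on one piece.
* `GuthMaynardReduction.largeValues_of_keyProp` — Theorem 1.1 from Proposition 3.1.
* `zeroDensity_guth_maynard_of_keyProp` — the named fact from Proposition 3.1.

## References

* L. Guth, J. Maynard, *New large value estimates for Dirichlet polynomials*, Ann. of Math. (2)
  203 (2026), no. 2; arXiv:2405.20552 (2024): Theorem 1.1, (1.1), §3 (Proposition 3.1 and the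
  proof of Theorem 1.1 assuming it).
* M. N. Huxley, *The Distribution of Prime Numbers*, Oxford 1972, Ch. 27, (27.27) (the large
  values theorem behind (1.1), via `Huxley1972_largeValues_holds`).
* H. L. Montgomery, *Topics in Multiplicative Number Theory*, LNM 227, Springer 1971, Ch. 7–8
  (the mean value and large values theorems; the cite `[M3]` of the paper).
-/

noncomputable section

open Real Set Filter Topology Complex MeasureTheory Finset Asymptotics

namespace Literature.NumberTheory.LFunctions

namespace GuthMaynardReduction

/-! ## §1. The classical large values estimates on `1`-separated real points -/

/-- `conj(m^{it}) = m^{-it}` for natural `m` and real `t`. [folklore] -/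
theorem conj_natCast_cpow_mul_I (m : ℕ) (t : ℝ) :
    (starRingEnd ℂ) ((m : ℂ) ^ ((t : ℂ) * I)) = (m : ℂ) ^ (-((t : ℂ) * I)) := by
  have h := HuxleyLV.conj_natCast_cpow m (-((t : ℂ) * I))
  rw [neg_neg] at h
  rw [h]
  congr 1
  rw [map_neg, map_mul, Complex.conj_ofReal, Complex.conj_I]
  ring

/-- **The mean value bound on real points** ("the classical Mean Value Theorem for Dirichlet
polynomials", the term `N²V⁻² + TNV⁻²` of Guth–Maynard (1.1); here the discrete mean value
theorem of the tree, `Gallagher.discreteMeanValue`): if `|b_n| ≤ 1` and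
`|∑_{N≤n≤2N} b_n n^{it}| ≥ V > 0` on a `1`-separated set `W ⊂ [0, T]` (`N, T ≥ 1`), then
`#W ≤ V⁻²(N+1)(5T + 3 + 36N)(1 + log 2N)`. [cite: GuthMaynard2026, Section 1, (1.1)] -/
theorem largeValues_mvt {T : ℝ} (hT : 1 ≤ T) {N : ℕ} (hN : 1 ≤ N) {b : ℕ → ℂ}
    (hb : ∀ n, ‖b n‖ ≤ 1) {V : ℝ} (hV : 0 < V) (W : Finset ℝ)
    (hW : ∀ t ∈ W, 0 ≤ t ∧ t ≤ T) (hsep : ∀ t ∈ W, ∀ t' ∈ W, t ≠ t' → 1 ≤ |t - t'|)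
    (hlarge : ∀ t ∈ W, V ≤ ‖∑ n ∈ Finset.Icc N (2 * N), b n * (n : ℂ) ^ ((t : ℂ) * I)‖) :
    (W.card : ℝ) ≤ V⁻¹ ^ 2 * (((N : ℝ) + 1) * ((5 * T + 3 + 36 * N) * (1 + Real.log (2 * (N : ℝ))))) := by
  classical
  have hN0 : (0 : ℝ) < N := by exact_mod_cast hN
  have hN1 : (1 : ℝ) ≤ N := by exact_mod_cast hN
  set a : ℕ → ℂ := fun n ↦ if n ∈ Finset.Icc N (2 * N) then (starRingEnd ℂ) (b n) else 0 with ha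
  have hsub : Finset.Icc N (2 * N) ⊆ Finset.Icc 1 (2 * N) := fun n hn ↦ by
    rw [Finset.mem_Icc] at hn ⊢; omega
  have hsumeq : ∀ t : ℝ, ∑ n ∈ Finset.Icc 1 (2 * N), a n * (n : ℂ) ^ (-((t : ℂ) * I)) =
      (starRingEnd ℂ) (∑ n ∈ Finset.Icc N (2 * N), b n * (n : ℂ) ^ ((t : ℂ) * I)) := by
    intro t
    rw [← Finset.sum_subset hsub (fun n _ hn ↦ by rw [ha]; dsimp only; rw [if_neg hn, zero_mul]),
      map_sum]
    refine Finset.sum_congr rfl fun n hn ↦ ?_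
    rw [ha]; dsimp only; rw [if_pos hn, map_mul, conj_natCast_cpow_mul_I]
  have hcoef : ∑ n ∈ Finset.Icc 1 (2 * N), ‖a n‖ ^ 2 ≤ (N : ℝ) + 1 := by
    rw [← Finset.sum_subset hsub (fun n _ hn ↦ by rw [ha]; dsimp only; rw [if_neg hn, norm_zero]; ring)]
    have h1 : ∀ n ∈ Finset.Icc N (2 * N), ‖a n‖ ^ 2 ≤ 1 := by
      intro n hn
      rw [ha]; dsimp only; rw [if_pos hn, Complex.norm_conj]
      exact pow_le_one₀ (norm_nonneg _) (hb n)
    calc ∑ n ∈ Finset.Icc N (2 * N), ‖a n‖ ^ 2 ≤ ∑ n ∈ Finset.Icc N (2 * N), (1 : ℝ) :=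
          Finset.sum_le_sum h1
      _ = (N : ℝ) + 1 := by
          rw [Finset.sum_const, Nat.card_Icc, nsmul_eq_mul, mul_one]
          have : 2 * N + 1 - N = N + 1 := by omega
          rw [this]; push_cast; ring
  have hmem : ∀ t ∈ W, |t| ≤ T := fun t ht ↦ by
    have := hW t ht; rw [abs_of_nonneg this.1]; exact this.2
  have hMV := Gallagher.discreteMeanValue a (2 * N) (by linarith) one_pos W hmem hsep
  simp only [inv_one] at hMV
  have hlog : Real.log ((2 * N : ℕ) : ℝ) = Real.log (2 * (N : ℝ)) := by push_cast; ring_nf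
  rw [hlog] at hMV
  have hlow : (W.card : ℝ) * V ^ 2 ≤
      ∑ t ∈ W, ‖∑ n ∈ Finset.Icc 1 (2 * N), a n * (n : ℂ) ^ (-((t : ℂ) * I))‖ ^ 2 := by
    calc (W.card : ℝ) * V ^ 2 = ∑ _t ∈ W, V ^ 2 := by simp
      _ ≤ _ := Finset.sum_le_sum fun t ht ↦ by
          rw [hsumeq t, Complex.norm_conj]; exact pow_le_pow_left₀ hV.le (hlarge t ht) 2
  have hlog0 : 0 ≤ Real.log (2 * (N : ℝ)) := Real.log_nonneg (by linarith)
  have hK0 : 0 ≤ (5 * (T + 1 / 2) + 18 * ((2 * N : ℕ) : ℝ)) * (1 + Real.log (2 * (N : ℝ))) := by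
    positivity
  have hup : ∑ t ∈ W, ‖∑ n ∈ Finset.Icc 1 (2 * N), a n * (n : ℂ) ^ (-((t : ℂ) * I))‖ ^ 2 ≤
      ((N : ℝ) + 1) * ((5 * T + 3 + 36 * N) * (1 + Real.log (2 * (N : ℝ)))) := by
    refine hMV.trans ?_
    calc (5 * (T + 1 / 2) + 18 * ((2 * N : ℕ) : ℝ)) * (1 + Real.log (2 * (N : ℝ))) *
          ∑ n ∈ Finset.Icc 1 (2 * N), ‖a n‖ ^ 2
        ≤ (5 * (T + 1 / 2) + 18 * ((2 * N : ℕ) : ℝ)) * (1 + Real.log (2 * (N : ℝ))) * ((N : ℝ) + 1) :=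
          mul_le_mul_of_nonneg_left hcoef hK0
      _ ≤ ((N : ℝ) + 1) * ((5 * T + 3 + 36 * N) * (1 + Real.log (2 * (N : ℝ)))) := by
          push_cast
          have h1 : (5 * (T + 1 / 2) + 18 * (2 * (N : ℝ))) ≤ 5 * T + 3 + 36 * N := by linarith
          have h2 : 0 ≤ ((N : ℝ) + 1) * (1 + Real.log (2 * (N : ℝ))) := by positivity
          nlinarith [mul_le_mul_of_nonneg_left h1 h2]
  have hV2 : 0 < V ^ 2 := by positivity
  calc (W.card : ℝ) = (W.card * V ^ 2) * V⁻¹ ^ 2 := by field_simp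
    _ ≤ (((N : ℝ) + 1) * ((5 * T + 3 + 36 * N) * (1 + Real.log (2 * (N : ℝ))))) * V⁻¹ ^ 2 :=
        mul_le_mul_of_nonneg_right (hlow.trans hup) (by positivity)
    _ = _ := by ring

/-- **The Montgomery–Halász–Huxley large values bound on real points** (the term
`N²V⁻² + TN⁴V⁻⁶` of Guth–Maynard (1.1), "the Montgomery-Halász-Huxley large values estimate";
here from Huxley's theorem (27.27), PROVED in the tree as `Huxley1972_largeValues_holds`, at the
points `s = it` after thinning the `1`-separated set to a `log 2N`-separated one,
`HuxleyZeroDensity.card_le_of_thinning`): there is an absolute `C` such that if `|b_n| ≤ 1` and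
`|∑_{N≤n≤2N} b_n n^{it}| ≥ V > 0` on a `1`-separated set `W ⊂ [0, T]` (`N, T ≥ 1`), then
`#W ≤ C (1 + log 2N)((N+1)(2N)V⁻² + (N+1)³(2N)TV⁻⁶ log⁴(2NT))`.
[cite: GuthMaynard2026, Section 1, (1.1)] [cite: Huxley1972, Ch. 27, (27.27)] -/
theorem largeValues_hmh : ∃ C : ℝ, 0 ≤ C ∧ ∀ (N : ℕ) (T V : ℝ) (b : ℕ → ℂ) (W : Finset ℝ),
    1 ≤ N → 1 ≤ T → 0 < V → (∀ n, ‖b n‖ ≤ 1) → (∀ t ∈ W, 0 ≤ t ∧ t ≤ T) →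
    (∀ t ∈ W, ∀ t' ∈ W, t ≠ t' → 1 ≤ |t - t'|) →
    (∀ t ∈ W, V ≤ ‖∑ n ∈ Finset.Icc N (2 * N), b n * (n : ℂ) ^ ((t : ℂ) * I)‖) →
    (W.card : ℝ) ≤ C * (1 + Real.log (2 * (N : ℝ))) *
      (((N : ℝ) + 1) * (2 * N) * V⁻¹ ^ 2 +
        ((N : ℝ) + 1) ^ 3 * (2 * N) * T * V⁻¹ ^ 6 * Real.log (2 * N * T) ^ 4) := by
  classical
  obtain ⟨C, hC⟩ := Huxley1972_largeValues_holds
  -- `C ≥ 0` may be assumed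
  set C' : ℝ := max C 0 with hC'
  refine ⟨2 * C', by positivity, fun N T V b W hN hT hV hb hW hsep hlarge ↦ ?_⟩
  have hN0 : (0 : ℝ) < N := by exact_mod_cast hN
  have hN1 : (1 : ℝ) ≤ N := by exact_mod_cast hN
  have hlog0 : 0 ≤ Real.log (2 * (N : ℝ)) := Real.log_nonneg (by linarith)
  have hlogT0 : 0 ≤ Real.log (2 * N * T) := Real.log_nonneg (by nlinarith)
  -- the complex points `it`
  set Z : Finset ℂ := W.image (fun t : ℝ ↦ (t : ℂ) * I) with hZ
  have himZ : ∀ t : ℝ, ((t : ℂ) * I).im = t := fun t ↦ by simp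
  have hreZ : ∀ t : ℝ, ((t : ℂ) * I).re = 0 := fun t ↦ by simp
  have hinj : Function.Injective (fun t : ℝ ↦ (t : ℂ) * I) := by
    intro t t' h
    have := congrArg Complex.im h
    simpa using this
  have hcard : Z.card = W.card := Finset.card_image_of_injective _ hinj
  have hmemZ : ∀ ρ ∈ Z, ∃ t ∈ W, (t : ℂ) * I = ρ := fun ρ hρ ↦ by
    rw [hZ, Finset.mem_image] at hρ; exact hρ
  -- thinning
  set k : ℕ := ⌈Real.log (2 * (N : ℝ))⌉₊ + 1 with hk
  have hk1 : 1 ≤ k := by rw [hk]; omega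
  have hklog : Real.log (2 * (N : ℝ)) ≤ (k : ℝ) - 1 := by
    rw [hk]; push_cast
    have := Nat.le_ceil (Real.log (2 * (N : ℝ)))
    linarith
  have hkle : (k : ℝ) ≤ 2 * (1 + Real.log (2 * (N : ℝ))) := by
    rw [hk]; push_cast
    have := (Nat.ceil_lt_add_one hlog0).le
    linarith
  have hpos : ∀ ρ ∈ Z, 0 ≤ ρ.im := by
    intro ρ hρ
    obtain ⟨t, ht, rfl⟩ := hmemZ ρ hρ
    rw [himZ]; exact (hW t ht).1
  have hsepZ : ∀ ρ ∈ Z, ∀ ρ' ∈ Z, ρ ≠ ρ' → 1 ≤ |ρ.im - ρ'.im| := by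
    intro ρ hρ ρ' hρ' hne
    obtain ⟨t, ht, rfl⟩ := hmemZ ρ hρ
    obtain ⟨t', ht', rfl⟩ := hmemZ ρ' hρ'
    rw [himZ, himZ]
    exact hsep t ht t' ht' (fun h ↦ hne (by rw [h]))
  -- the coefficients
  set a : ℕ → ℂ := fun n ↦ if n ∈ Finset.Icc N (2 * N) then (starRingEnd ℂ) (b n) else 0 with ha
  have hsub : Finset.Icc N (2 * N) ⊆ Finset.Icc 1 (2 * N) := fun n hn ↦ by
    rw [Finset.mem_Icc] at hn ⊢; omega
  have hsumeq : ∀ t : ℝ, ∑ n ∈ Finset.Icc 1 (2 * N), a n * (n : ℂ) ^ (-((t : ℂ) * I)) =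
      (starRingEnd ℂ) (∑ n ∈ Finset.Icc N (2 * N), b n * (n : ℂ) ^ ((t : ℂ) * I)) := by
    intro t
    rw [← Finset.sum_subset hsub (fun n _ hn ↦ by rw [ha]; dsimp only; rw [if_neg hn, zero_mul]),
      map_sum]
    refine Finset.sum_congr rfl fun n hn ↦ ?_
    rw [ha]; dsimp only; rw [if_pos hn, map_mul, conj_natCast_cpow_mul_I]
  have hG : ∑ n ∈ Finset.Icc 1 (2 * N), ‖a n‖ ^ 2 ≤ (N : ℝ) + 1 := by
    rw [← Finset.sum_subset hsub (fun n _ hn ↦ by rw [ha]; dsimp only; rw [if_neg hn, norm_zero]; ring)]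
    have h1 : ∀ n ∈ Finset.Icc N (2 * N), ‖a n‖ ^ 2 ≤ 1 := by
      intro n hn
      rw [ha]; dsimp only; rw [if_pos hn, Complex.norm_conj]
      exact pow_le_one₀ (norm_nonneg _) (hb n)
    calc ∑ n ∈ Finset.Icc N (2 * N), ‖a n‖ ^ 2 ≤ ∑ n ∈ Finset.Icc N (2 * N), (1 : ℝ) :=
          Finset.sum_le_sum h1
      _ = (N : ℝ) + 1 := by
          rw [Finset.sum_const, Nat.card_Icc, nsmul_eq_mul, mul_one]
          have : 2 * N + 1 - N = N + 1 := by omega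
          rw [this]; push_cast; ring
  have hG0 : 0 ≤ ∑ n ∈ Finset.Icc 1 (2 * N), ‖a n‖ ^ 2 := Finset.sum_nonneg fun n _ ↦ by positivity
  -- the bound on each thinned class
  set B : ℝ := C' * (((N : ℝ) + 1) * (2 * N) * V⁻¹ ^ 2 +
      ((N : ℝ) + 1) ^ 3 * (2 * N) * T * V⁻¹ ^ 6 * Real.log (2 * N * T) ^ 4) with hB
  have hclass : ∀ Z' ⊆ Z, (∀ ρ ∈ Z', ∀ ρ' ∈ Z', ρ ≠ ρ' → (k : ℝ) - 1 ≤ |ρ.im - ρ'.im|) →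
      (Z'.card : ℝ) ≤ B := by
    intro Z' hZ' hsep'
    have hre' : ∀ s ∈ Z', 0 ≤ s.re ∧ s.re ≤ 1 / 3 := by
      intro s hs
      obtain ⟨t, -, rfl⟩ := hmemZ s (hZ' hs)
      rw [hreZ]; norm_num
    have hsep'' : ∀ s ∈ Z', ∀ s' ∈ Z', s ≠ s' →
        Real.log ((2 * N : ℕ) : ℝ) ≤ |s.im - s'.im| ∧ |s.im - s'.im| ≤ T := by
      intro s hs s' hs' hne
      refine ⟨?_, ?_⟩
      · have := hsep' s hs s' hs' hne
        push_cast
        linarith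
      · obtain ⟨t, ht, rfl⟩ := hmemZ s (hZ' hs)
        obtain ⟨t', ht', rfl⟩ := hmemZ s' (hZ' hs')
        rw [himZ, himZ]
        have h1 := hW t ht
        have h2 := hW t' ht'
        rw [abs_le]; constructor <;> linarith
    have hlarge' : ∀ s ∈ Z', V ≤ ‖∑ m ∈ Finset.Icc 1 (2 * N), a m * (m : ℂ) ^ (-s)‖ := by
      intro s hs
      obtain ⟨t, ht, rfl⟩ := hmemZ s (hZ' hs)
      rw [hsumeq t, Complex.norm_conj]
      exact hlarge t ht
    have h2N : 2 ≤ 2 * N := by omega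
    have h := hC (2 * N) a T V Z' h2N hT hV hre' hsep'' hlarge'
    refine h.trans ?_
    have hCC' : C ≤ C' := le_max_left _ _
    have hC'0 : 0 ≤ C' := le_max_right _ _
    push_cast at h ⊢
    have hlog4 : 0 ≤ Real.log (2 * N * T) ^ 4 := by positivity
    have hin : 0 ≤ (∑ n ∈ Finset.Icc 1 (2 * N), ‖a n‖ ^ 2) * (2 * (N : ℝ)) * V⁻¹ ^ 2 +
        (∑ n ∈ Finset.Icc 1 (2 * N), ‖a n‖ ^ 2) ^ 3 * (2 * (N : ℝ)) * T * V⁻¹ ^ 6 *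
          Real.log (2 * N * T) ^ 4 := by positivity
    calc C * ((∑ n ∈ Finset.Icc 1 (2 * N), ‖a n‖ ^ 2) * (2 * (N : ℝ)) * V⁻¹ ^ 2 +
          (∑ n ∈ Finset.Icc 1 (2 * N), ‖a n‖ ^ 2) ^ 3 * (2 * (N : ℝ)) * T * V⁻¹ ^ 6 *
            Real.log (2 * N * T) ^ 4)
        ≤ C' * ((∑ n ∈ Finset.Icc 1 (2 * N), ‖a n‖ ^ 2) * (2 * (N : ℝ)) * V⁻¹ ^ 2 +
          (∑ n ∈ Finset.Icc 1 (2 * N), ‖a n‖ ^ 2) ^ 3 * (2 * (N : ℝ)) * T * V⁻¹ ^ 6 *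
            Real.log (2 * N * T) ^ 4) := mul_le_mul_of_nonneg_right hCC' hin
      _ ≤ B := by rw [hB]; gcongr
  have hthin := HuxleyZeroDensity.card_le_of_thinning Z hk1 hpos hsepZ hclass
  have hB0 : 0 ≤ B := by rw [hB]; positivity
  rw [hcard] at hthin
  calc (W.card : ℝ) ≤ k * B := hthin
    _ ≤ (2 * (1 + Real.log (2 * (N : ℝ)))) * B := mul_le_mul_of_nonneg_right hkle hB0
    _ = _ := by rw [hB]; ring

/-! ## §2. Separated sets of reals: counting, thinning, subdivision -/

/-- Two reals at distance `≥ 1` have different integer parts. [folklore] -/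
theorem natFloor_ne_of_one_le_abs {x y : ℝ} (hx : 0 ≤ x) (hy : 0 ≤ y) (h : 1 ≤ |x - y|) :
    ⌊x⌋₊ ≠ ⌊y⌋₊ := by
  intro he
  have hx1 := Nat.floor_le hx
  have hx2 := Nat.lt_floor_add_one x
  have hy1 := Nat.floor_le hy
  have hy2 := Nat.lt_floor_add_one y
  rw [he] at hx1 hx2
  have : |x - y| < 1 := by rw [abs_lt]; constructor <;> linarith
  linarith

/-- **A `1`-separated subset of `[0, T]` has at most `T + 1` elements** (the integer parts are
distinct and lie in `{0, …, ⌊T⌋}`). [folklore] -/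
theorem card_le_of_one_sep {T : ℝ} (hT : 0 ≤ T) (W : Finset ℝ) (hW : ∀ t ∈ W, 0 ≤ t ∧ t ≤ T)
    (hsep : ∀ t ∈ W, ∀ t' ∈ W, t ≠ t' → 1 ≤ |t - t'|) : (W.card : ℝ) ≤ T + 1 := by
  classical
  have hinj : Set.InjOn (fun t : ℝ ↦ ⌊t⌋₊) (W : Set ℝ) := by
    intro t ht t' ht' he
    by_contra hne
    exact natFloor_ne_of_one_le_abs (hW t ht).1 (hW t' ht').1 (hsep t ht t' ht' hne) he
  have hmaps : ∀ t ∈ W, ⌊t⌋₊ ∈ Finset.range (⌊T⌋₊ + 1) := by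
    intro t ht
    rw [Finset.mem_range]
    have := Nat.floor_le_floor (hW t ht).2
    omega
  have h1 : W.card ≤ (Finset.range (⌊T⌋₊ + 1)).card := Finset.card_le_card_of_injOn _ hmaps hinj
  rw [Finset.card_range] at h1
  have h2 : (W.card : ℝ) ≤ ⌊T⌋₊ + 1 := by exact_mod_cast h1
  exact h2.trans (by linarith [Nat.floor_le hT])

/-- **Thinning a `1`-separated set of reals** (the real form of
`HuxleyZeroDensity.card_le_of_thinning`: the classes `⌊t⌋ mod k` are `(k−1)`-separated):
if every `(k−1)`-separated subset has at most `B` elements, the set has at most `kB`.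
(Guth–Maynard §3: "we choose `W' ⊂ W` so that `W'` is `T^η`-separated and `|W'| ≥ |W|/T^η`".)
[cite: GuthMaynard2026, Section 3] -/
theorem card_le_of_thinning_real (W : Finset ℝ) {k : ℕ} (hk : 1 ≤ k) {B : ℝ}
    (hpos : ∀ t ∈ W, 0 ≤ t) (hsep : ∀ t ∈ W, ∀ t' ∈ W, t ≠ t' → 1 ≤ |t - t'|)
    (hB : ∀ W' ⊆ W, (∀ t ∈ W', ∀ t' ∈ W', t ≠ t' → (k : ℝ) - 1 ≤ |t - t'|) → (W'.card : ℝ) ≤ B) :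
    (W.card : ℝ) ≤ k * B := by
  classical
  set Z : Finset ℂ := W.image (fun t : ℝ ↦ (t : ℂ) * I) with hZ
  have himZ : ∀ t : ℝ, ((t : ℂ) * I).im = t := fun t ↦ by simp
  have hinj : Function.Injective (fun t : ℝ ↦ (t : ℂ) * I) := by
    intro t t' h
    have := congrArg Complex.im h
    simpa using this
  have hcard : Z.card = W.card := Finset.card_image_of_injective _ hinj
  have hmemZ : ∀ ρ ∈ Z, ∃ t ∈ W, (t : ℂ) * I = ρ := fun ρ hρ ↦ by
    rw [hZ, Finset.mem_image] at hρ; exact hρ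
  have hposZ : ∀ ρ ∈ Z, 0 ≤ ρ.im := by
    intro ρ hρ
    obtain ⟨t, ht, rfl⟩ := hmemZ ρ hρ
    rw [himZ]; exact hpos t ht
  have hsepZ : ∀ ρ ∈ Z, ∀ ρ' ∈ Z, ρ ≠ ρ' → 1 ≤ |ρ.im - ρ'.im| := by
    intro ρ hρ ρ' hρ' hne
    obtain ⟨t, ht, rfl⟩ := hmemZ ρ hρ
    obtain ⟨t', ht', rfl⟩ := hmemZ ρ' hρ'
    rw [himZ, himZ]
    exact hsep t ht t' ht' (fun h ↦ hne (by rw [h]))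
  have hBZ : ∀ Z' ⊆ Z, (∀ ρ ∈ Z', ∀ ρ' ∈ Z', ρ ≠ ρ' → (k : ℝ) - 1 ≤ |ρ.im - ρ'.im|) →
      (Z'.card : ℝ) ≤ B := by
    intro Z' hZ' hsep'
    set W' : Finset ℝ := Z'.image Complex.im with hW'
    have hW'W : W' ⊆ W := by
      intro t ht
      rw [hW', Finset.mem_image] at ht
      obtain ⟨ρ, hρ, rfl⟩ := ht
      obtain ⟨t, ht, rfl⟩ := hmemZ ρ (hZ' hρ)
      rw [himZ]; exact ht
    have hinj' : Set.InjOn Complex.im (Z' : Set ℂ) := by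
      intro ρ hρ ρ' hρ' he
      obtain ⟨t, -, rfl⟩ := hmemZ ρ (hZ' hρ)
      obtain ⟨t', -, rfl⟩ := hmemZ ρ' (hZ' hρ')
      rw [himZ, himZ] at he
      rw [he]
    have hcard' : W'.card = Z'.card := Finset.card_image_of_injOn hinj'
    have hsepW' : ∀ t ∈ W', ∀ t' ∈ W', t ≠ t' → (k : ℝ) - 1 ≤ |t - t'| := by
      intro t ht t' ht' hne
      rw [hW', Finset.mem_image] at ht ht'
      obtain ⟨ρ, hρ, rfl⟩ := ht
      obtain ⟨ρ', hρ', rfl⟩ := ht'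
      exact hsep' ρ hρ ρ' hρ' (fun h ↦ hne (by rw [h]))
    have := hB W' hW'W hsepW'
    rw [hcard'] at this
    exact this
  have hthin := HuxleyZeroDensity.card_le_of_thinning Z hk hposZ hsepZ hBZ
  rwa [hcard] at hthin

/-- **Subdivision of `[0, T]` into intervals of length `L`** (Guth–Maynard §3: "we divide `W'`
into `⌈T/N^{6/5}⌉` subsets each supported on an interval of length `N^{6/5}`"): if every subset
of `W ⊂ [0, T]` lying in an interval `[t₀, t₀ + L]` has at most `B ≥ 0` elements, then
`#W ≤ (T/L + 1) B`. [cite: GuthMaynard2026, Section 3] -/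
theorem card_le_of_subdivision {T L B : ℝ} (hT : 0 ≤ T) (hL : 0 < L) (hB0 : 0 ≤ B)
    (W : Finset ℝ) (hW : ∀ t ∈ W, 0 ≤ t ∧ t ≤ T)
    (hB : ∀ (t₀ : ℝ), ∀ W' ⊆ W, (∀ t ∈ W', t₀ ≤ t ∧ t ≤ t₀ + L) → (W'.card : ℝ) ≤ B) :
    (W.card : ℝ) ≤ (T / L + 1) * B := by
  classical
  set M : ℕ := ⌊T / L⌋₊ + 1 with hM
  set cls : ℝ → ℕ := fun t ↦ ⌊t / L⌋₊ with hcls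
  have hcover : W ⊆ (Finset.range M).biUnion (fun m ↦ W.filter (fun t ↦ cls t = m)) := by
    intro t ht
    rw [Finset.mem_biUnion]
    refine ⟨cls t, ?_, by rw [Finset.mem_filter]; exact ⟨ht, rfl⟩⟩
    rw [Finset.mem_range, hM]
    have : ⌊t / L⌋₊ ≤ ⌊T / L⌋₊ := Nat.floor_le_floor (div_le_div_of_nonneg_right (hW t ht).2 hL.le)
    show ⌊t / L⌋₊ < ⌊T / L⌋₊ + 1
    omega
  have hclass : ∀ m ∈ Finset.range M, ((W.filter (fun t ↦ cls t = m)).card : ℝ) ≤ B := by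
    intro m _
    refine hB (m * L) _ (Finset.filter_subset _ _) fun t ht ↦ ?_
    rw [Finset.mem_filter] at ht
    obtain ⟨htW, hm⟩ := ht
    have ht0 : 0 ≤ t / L := div_nonneg (hW t htW).1 hL.le
    have h1 : (⌊t / L⌋₊ : ℝ) ≤ t / L := Nat.floor_le ht0
    have h2 : t / L < ⌊t / L⌋₊ + 1 := Nat.lt_floor_add_one _
    rw [hcls] at hm; simp only at hm
    rw [hm] at h1 h2
    rw [le_div_iff₀ hL] at h1
    rw [div_lt_iff₀ hL] at h2
    constructor <;> linarith
  have hMle : (M : ℝ) ≤ T / L + 1 := by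
    rw [hM]; push_cast
    linarith [Nat.floor_le (div_nonneg hT hL.le)]
  calc (W.card : ℝ) ≤ (((Finset.range M).biUnion (fun m ↦ W.filter (fun t ↦ cls t = m))).card : ℝ) := by
        exact_mod_cast Finset.card_le_card hcover
    _ ≤ ∑ m ∈ Finset.range M, ((W.filter (fun t ↦ cls t = m)).card : ℝ) := by
        exact_mod_cast Finset.card_biUnion_le
    _ ≤ ∑ m ∈ Finset.range M, B := Finset.sum_le_sum hclass
    _ = M * B := by rw [Finset.sum_const, Finset.card_range, nsmul_eq_mul]
    _ ≤ (T / L + 1) * B := mul_le_mul_of_nonneg_right hMle hB0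

/-- **Thinning and subdivision combined**: if every subset of `W ⊂ [0, T]` (`W` `1`-separated)
that is `S`-separated (`S ≥ 1`) and lies in an interval of length `L > 0` has at most `B ≥ 0`
elements, then `#W ≤ (S + 2)(T/L + 1) B`. [cite: GuthMaynard2026, Section 3] -/
theorem card_le_of_sep_of_short {T L S B : ℝ} (hT : 0 ≤ T) (hL : 0 < L) (hS : 1 ≤ S)
    (hB0 : 0 ≤ B) (W : Finset ℝ) (hW : ∀ t ∈ W, 0 ≤ t ∧ t ≤ T)
    (hsep : ∀ t ∈ W, ∀ t' ∈ W, t ≠ t' → 1 ≤ |t - t'|)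
    (hB : ∀ (t₀ : ℝ), ∀ W' ⊆ W, (∀ t ∈ W', t₀ ≤ t ∧ t ≤ t₀ + L) →
      (∀ t ∈ W', ∀ t' ∈ W', t ≠ t' → S ≤ |t - t'|) → (W'.card : ℝ) ≤ B) :
    (W.card : ℝ) ≤ (S + 2) * ((T / L + 1) * B) := by
  set k : ℕ := ⌈S⌉₊ + 1 with hk
  have hk1 : 1 ≤ k := by rw [hk]; omega
  have hkS : S ≤ (k : ℝ) - 1 := by
    rw [hk]; push_cast; linarith [Nat.le_ceil S]
  have hkle : (k : ℝ) ≤ S + 2 := by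
    rw [hk]; push_cast; linarith [(Nat.ceil_lt_add_one (by linarith : (0 : ℝ) ≤ S)).le]
  have hthin : ∀ W' ⊆ W, (∀ t ∈ W', ∀ t' ∈ W', t ≠ t' → (k : ℝ) - 1 ≤ |t - t'|) →
      (W'.card : ℝ) ≤ (T / L + 1) * B := by
    intro W' hW'W hsep'
    refine card_le_of_subdivision hT hL hB0 W' (fun t ht ↦ hW t (hW'W ht)) fun t₀ W'' hW'' hI ↦ ?_
    exact hB t₀ W'' (hW''.trans hW'W) hI fun t ht t' ht' hne ↦
      hkS.trans (hsep' t (hW'' ht) t' (hW'' ht') hne)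
  have h := card_le_of_thinning_real W hk1 (fun t ht ↦ (hW t ht).1) hsep hthin
  exact h.trans (mul_le_mul_of_nonneg_right hkle (by positivity))

/-! ## §3. The three pieces of `[N, 2N]` -/

/-- **Splitting `D(t)` into three pieces** (Guth–Maynard §3: "By splitting `D(t)` into 3
separate pieces (and using the triangle bound) …"): with the pieces `5n < 6N`,
`6N ≤ 5n ≤ 9N`, `9N < 5n` of `[N, 2N]`. [cite: GuthMaynard2026, Section 3] -/
theorem norm_sum_Icc_le_three_pieces (N : ℕ) (f : ℕ → ℂ) :
    ‖∑ n ∈ Finset.Icc N (2 * N), f n‖ ≤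
      ‖∑ n ∈ (Finset.Icc N (2 * N)).filter (fun n ↦ 5 * n < 6 * N), f n‖ +
      ‖∑ n ∈ (Finset.Icc N (2 * N)).filter (fun n ↦ 6 * N ≤ 5 * n ∧ 5 * n ≤ 9 * N), f n‖ +
      ‖∑ n ∈ (Finset.Icc N (2 * N)).filter (fun n ↦ 9 * N < 5 * n), f n‖ := by
  classical
  have h1 := (Finset.sum_filter_add_sum_filter_not (Finset.Icc N (2 * N)) (fun n ↦ 5 * n < 6 * N) f).symm
  have h2 := (Finset.sum_filter_add_sum_filter_not
    ((Finset.Icc N (2 * N)).filter (fun n ↦ ¬ 5 * n < 6 * N)) (fun n ↦ 5 * n ≤ 9 * N) f).symm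
  have e2 : ((Finset.Icc N (2 * N)).filter (fun n ↦ ¬ 5 * n < 6 * N)).filter (fun n ↦ 5 * n ≤ 9 * N) =
      (Finset.Icc N (2 * N)).filter (fun n ↦ 6 * N ≤ 5 * n ∧ 5 * n ≤ 9 * N) := by
    rw [Finset.filter_filter]
    congr 1; ext n; constructor
    · rintro ⟨h1, h2⟩; exact ⟨not_lt.1 h1, h2⟩
    · rintro ⟨h1, h2⟩; exact ⟨not_lt.2 h1, h2⟩
  have e3 : ((Finset.Icc N (2 * N)).filter (fun n ↦ ¬ 5 * n < 6 * N)).filter (fun n ↦ ¬ 5 * n ≤ 9 * N) =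
      (Finset.Icc N (2 * N)).filter (fun n ↦ 9 * N < 5 * n) := by
    rw [Finset.filter_filter]
    congr 1; ext n; constructor
    · rintro ⟨-, h2⟩; exact not_le.1 h2
    · intro h; exact ⟨not_lt.2 (by omega), not_le.2 h⟩
  rw [e2, e3] at h2
  rw [h1, h2]
  refine (norm_add_le _ _).trans ?_
  have := norm_add_le (∑ n ∈ (Finset.Icc N (2 * N)).filter (fun n ↦ 6 * N ≤ 5 * n ∧ 5 * n ≤ 9 * N), f n)
    (∑ n ∈ (Finset.Icc N (2 * N)).filter (fun n ↦ 9 * N < 5 * n), f n)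
  linarith

/-- **Inserting the weight `w(n/N')`** (Guth–Maynard §3: "Since the function `w` is `1` on
`[6/5, 9/5]`, we then have that `b_n = b_n w(n/N)`, so we may insert the weight `w(n/N)` …
we now relax the vanishing condition"): if `w = 1` on `[6/5, 9/5]` and every `n ∈ P` has
`6N' ≤ 5n ≤ 9N'`, then with `a = b·1_P` (a `1`-bounded sequence if `b` is),
`∑_{N'≤n≤2N'} w(n/N') a_n n^{it} = ∑_{n∈P} b_n n^{it}`. [cite: GuthMaynard2026, Section 3] -/
theorem sum_weight_indicator_eq {w : ℝ → ℝ} (hw : ∀ u : ℝ, 6 / 5 ≤ u → u ≤ 9 / 5 → w u = 1)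
    {N' : ℕ} (hN' : 1 ≤ N') (P : Finset ℕ) (hP : ∀ n ∈ P, 6 * N' ≤ 5 * n ∧ 5 * n ≤ 9 * N')
    (b : ℕ → ℂ) (t : ℝ) :
    ∑ n ∈ Finset.Icc N' (2 * N'), ((w ((n : ℝ) / N') : ℝ) : ℂ) *
        (if n ∈ P then b n else 0) * (n : ℂ) ^ ((t : ℂ) * I) =
      ∑ n ∈ P, b n * (n : ℂ) ^ ((t : ℂ) * I) := by
  classical
  have hPsub : P ⊆ Finset.Icc N' (2 * N') := by
    intro n hn
    have := hP n hn
    rw [Finset.mem_Icc]; omega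
  rw [← Finset.sum_subset hPsub (fun n _ hn ↦ by rw [if_neg hn]; ring)]
  refine Finset.sum_congr rfl fun n hn ↦ ?_
  have hN'0 : (0 : ℝ) < N' := by exact_mod_cast hN'
  obtain ⟨h1, h2⟩ := hP n hn
  have hu1 : (6 / 5 : ℝ) ≤ (n : ℝ) / N' := by
    rw [le_div_iff₀ hN'0]
    have : (6 * N' : ℝ) ≤ 5 * n := by exact_mod_cast h1
    linarith
  have hu2 : (n : ℝ) / N' ≤ 9 / 5 := by
    rw [div_le_iff₀ hN'0]
    have : (5 * n : ℝ) ≤ 9 * N' := by exact_mod_cast h2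
    linarith
  rw [hw _ hu1 hu2, if_pos hn]
  push_cast; ring

/-! ## §4. Small and large `V`: the classical bounds -/

/-- **Small `V`** (Guth–Maynard §3: "the result follows from (1.1) if `V ≤ N^{7/10+o(1)}`"): for
`V ≤ 4N^{7/10}`, `N ≤ T`, the mean value bound gives `#W ≤ 1408 (1 + log 2T) · TN^{12/5}V⁻⁴`.
[cite: GuthMaynard2026, Section 3] -/
theorem largeValues_smallV {T : ℝ} (hT : 1 ≤ T) {N : ℕ} (hN : 1 ≤ N) (hNT : (N : ℝ) ≤ T)
    {b : ℕ → ℂ} (hb : ∀ n, ‖b n‖ ≤ 1) {V : ℝ} (hV : 0 < V)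
    (hVs : V ≤ 4 * (N : ℝ) ^ (7 / 10 : ℝ)) (W : Finset ℝ)
    (hW : ∀ t ∈ W, 0 ≤ t ∧ t ≤ T) (hsep : ∀ t ∈ W, ∀ t' ∈ W, t ≠ t' → 1 ≤ |t - t'|)
    (hlarge : ∀ t ∈ W, V ≤ ‖∑ n ∈ Finset.Icc N (2 * N), b n * (n : ℂ) ^ ((t : ℂ) * I)‖) :
    (W.card : ℝ) ≤ 1408 * (1 + Real.log (2 * T)) * (T * (N : ℝ) ^ (12 / 5 : ℝ) * V⁻¹ ^ 4) := by
  have hN0 : (0 : ℝ) < N := by exact_mod_cast hN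
  have hN1 : (1 : ℝ) ≤ N := by exact_mod_cast hN
  have h := largeValues_mvt hT hN hb hV W hW hsep hlarge
  have hlog : Real.log (2 * (N : ℝ)) ≤ Real.log (2 * T) := Real.log_le_log (by linarith) (by linarith)
  have hlog0 : 0 ≤ Real.log (2 * (N : ℝ)) := Real.log_nonneg (by linarith)
  have h1 : ((N : ℝ) + 1) * ((5 * T + 3 + 36 * N) * (1 + Real.log (2 * (N : ℝ)))) ≤
      (2 * N) * ((44 * T) * (1 + Real.log (2 * T))) := by
    have ha : (N : ℝ) + 1 ≤ 2 * N := by linarith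
    have hb' : 5 * T + 3 + 36 * (N : ℝ) ≤ 44 * T := by linarith
    have hc : 1 + Real.log (2 * (N : ℝ)) ≤ 1 + Real.log (2 * T) := by linarith
    have := mul_le_mul hb' hc (by positivity) (by positivity)
    exact mul_le_mul ha this (by positivity) (by positivity)
  -- `V² ≤ 16 N^{7/5}`
  have hV2 : V ^ 2 ≤ 16 * (N : ℝ) ^ (7 / 5 : ℝ) := by
    have e : (4 * (N : ℝ) ^ (7 / 10 : ℝ)) ^ 2 = 16 * (N : ℝ) ^ (7 / 5 : ℝ) := by
      rw [mul_pow, ← Real.rpow_natCast ((N : ℝ) ^ (7 / 10 : ℝ)), ← Real.rpow_mul hN0.le]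
      norm_num
    rw [← e]; exact pow_le_pow_left₀ hV.le hVs 2
  have hkey : V⁻¹ ^ 2 * (N : ℝ) ≤ 16 * ((N : ℝ) ^ (12 / 5 : ℝ) * V⁻¹ ^ 4) := by
    have e1 : V⁻¹ ^ 2 * (N : ℝ) = V⁻¹ ^ 4 * (V ^ 2 * N) := by field_simp
    have e2 : (N : ℝ) ^ (7 / 5 : ℝ) * N = (N : ℝ) ^ (12 / 5 : ℝ) := by
      conv_lhs => rw [show (N : ℝ) ^ (7 / 5 : ℝ) * N = (N : ℝ) ^ (7 / 5 : ℝ) * (N : ℝ) ^ (1 : ℝ) by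
        rw [Real.rpow_one]]
      rw [← Real.rpow_add hN0]; norm_num
    rw [e1]
    calc V⁻¹ ^ 4 * (V ^ 2 * N) ≤ V⁻¹ ^ 4 * (16 * (N : ℝ) ^ (7 / 5 : ℝ) * N) := by
          refine mul_le_mul_of_nonneg_left ?_ (by positivity)
          exact mul_le_mul_of_nonneg_right hV2 hN0.le
      _ = 16 * ((N : ℝ) ^ (12 / 5 : ℝ) * V⁻¹ ^ 4) := by rw [mul_assoc, e2]; ring
  calc (W.card : ℝ) ≤ V⁻¹ ^ 2 * (((N : ℝ) + 1) * ((5 * T + 3 + 36 * N) * (1 + Real.log (2 * (N : ℝ))))) := h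
    _ ≤ V⁻¹ ^ 2 * ((2 * N) * ((44 * T) * (1 + Real.log (2 * T)))) :=
        mul_le_mul_of_nonneg_left h1 (by positivity)
    _ = 88 * (1 + Real.log (2 * T)) * T * (V⁻¹ ^ 2 * N) := by ring
    _ ≤ 88 * (1 + Real.log (2 * T)) * T * (16 * ((N : ℝ) ^ (12 / 5 : ℝ) * V⁻¹ ^ 4)) := by
        refine mul_le_mul_of_nonneg_left hkey ?_
        have : 0 ≤ Real.log (2 * T) := Real.log_nonneg (by linarith)
        positivity
    _ = 1408 * (1 + Real.log (2 * T)) * (T * (N : ℝ) ^ (12 / 5 : ℝ) * V⁻¹ ^ 4) := by ring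

/-- **Large `V`** (Guth–Maynard §3: "… or if `V ≥ N^{8/10−o(1)}`"): for `V ≥ N^{4/5}`, `N ≤ T`,
the Montgomery–Halász–Huxley bound (constant `C_h`, in the form of `largeValues_hmh`) gives
`#W ≤ 16 C_h (1 + log 2T) log⁴(2T²) · (N²V⁻² + TN^{12/5}V⁻⁴)`. [cite: GuthMaynard2026, Section 3] -/
theorem largeValues_largeV {C_h : ℝ} (hCh0 : 0 ≤ C_h)
    (hCh : ∀ (N : ℕ) (T V : ℝ) (b : ℕ → ℂ) (W : Finset ℝ),
      1 ≤ N → 1 ≤ T → 0 < V → (∀ n, ‖b n‖ ≤ 1) → (∀ t ∈ W, 0 ≤ t ∧ t ≤ T) →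
      (∀ t ∈ W, ∀ t' ∈ W, t ≠ t' → 1 ≤ |t - t'|) →
      (∀ t ∈ W, V ≤ ‖∑ n ∈ Finset.Icc N (2 * N), b n * (n : ℂ) ^ ((t : ℂ) * I)‖) →
      (W.card : ℝ) ≤ C_h * (1 + Real.log (2 * (N : ℝ))) *
        (((N : ℝ) + 1) * (2 * N) * V⁻¹ ^ 2 +
          ((N : ℝ) + 1) ^ 3 * (2 * N) * T * V⁻¹ ^ 6 * Real.log (2 * N * T) ^ 4))
    {T : ℝ} (hT : 1 ≤ T) {N : ℕ} (hN : 1 ≤ N) (hNT : (N : ℝ) ≤ T)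
    {b : ℕ → ℂ} (hb : ∀ n, ‖b n‖ ≤ 1) {V : ℝ} (hV : 0 < V)
    (hVl : (N : ℝ) ^ (4 / 5 : ℝ) ≤ V) (W : Finset ℝ)
    (hW : ∀ t ∈ W, 0 ≤ t ∧ t ≤ T) (hsep : ∀ t ∈ W, ∀ t' ∈ W, t ≠ t' → 1 ≤ |t - t'|)
    (hlarge : ∀ t ∈ W, V ≤ ‖∑ n ∈ Finset.Icc N (2 * N), b n * (n : ℂ) ^ ((t : ℂ) * I)‖) :
    (W.card : ℝ) ≤ 16 * C_h * ((1 + Real.log (2 * T)) * (1 + Real.log (2 * T ^ 2)) ^ 4) *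
      ((N : ℝ) ^ 2 * V⁻¹ ^ 2 + T * (N : ℝ) ^ (12 / 5 : ℝ) * V⁻¹ ^ 4) := by
  have hN0 : (0 : ℝ) < N := by exact_mod_cast hN
  have hN1 : (1 : ℝ) ≤ N := by exact_mod_cast hN
  have h := hCh N T V b W hN hT hV hb hW hsep hlarge
  have hlog0 : 0 ≤ Real.log (2 * (N : ℝ)) := Real.log_nonneg (by linarith)
  have hlogT0 : 0 ≤ Real.log (2 * T) := Real.log_nonneg (by linarith)
  have hlog : Real.log (2 * (N : ℝ)) ≤ Real.log (2 * T) := Real.log_le_log (by linarith) (by linarith)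
  have hlogNT0 : 0 ≤ Real.log (2 * N * T) := Real.log_nonneg (by nlinarith)
  have hlogNT : Real.log (2 * N * T) ≤ 1 + Real.log (2 * T ^ 2) := by
    have h1 : Real.log (2 * N * T) ≤ Real.log (2 * T ^ 2) :=
      Real.log_le_log (by positivity) (by nlinarith)
    linarith
  have hlogNT4 : Real.log (2 * N * T) ^ 4 ≤ (1 + Real.log (2 * T ^ 2)) ^ 4 :=
    pow_le_pow_left₀ hlogNT0 hlogNT 4
  -- `N⁴ V⁻⁶ ≤ N^{12/5} V⁻⁴`
  have hV2 : (N : ℝ) ^ (8 / 5 : ℝ) ≤ V ^ 2 := by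
    have e : ((N : ℝ) ^ (4 / 5 : ℝ)) ^ 2 = (N : ℝ) ^ (8 / 5 : ℝ) := by
      rw [← Real.rpow_natCast ((N : ℝ) ^ (4 / 5 : ℝ)), ← Real.rpow_mul hN0.le]; norm_num
    rw [← e]; exact pow_le_pow_left₀ (by positivity) hVl 2
  have hkey : ((N : ℝ) + 1) ^ 3 * (2 * N) * V⁻¹ ^ 6 ≤ 16 * ((N : ℝ) ^ (12 / 5 : ℝ) * V⁻¹ ^ 4) := by
    have h1 : ((N : ℝ) + 1) ^ 3 * (2 * N) ≤ 16 * (N : ℝ) ^ 4 := by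
      have : (N : ℝ) + 1 ≤ 2 * N := by linarith
      calc ((N : ℝ) + 1) ^ 3 * (2 * N) ≤ (2 * (N : ℝ)) ^ 3 * (2 * N) := by gcongr
        _ = 16 * (N : ℝ) ^ 4 := by ring
    have e4 : (N : ℝ) ^ 4 = (N : ℝ) ^ (12 / 5 : ℝ) * (N : ℝ) ^ (8 / 5 : ℝ) := by
      rw [← Real.rpow_add hN0]; norm_num
    have hV0' : 0 < V ^ 2 := by positivity
    calc ((N : ℝ) + 1) ^ 3 * (2 * N) * V⁻¹ ^ 6 ≤ 16 * (N : ℝ) ^ 4 * V⁻¹ ^ 6 :=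
          mul_le_mul_of_nonneg_right h1 (by positivity)
      _ = 16 * ((N : ℝ) ^ (12 / 5 : ℝ) * V⁻¹ ^ 4) * ((N : ℝ) ^ (8 / 5 : ℝ) * V⁻¹ ^ 2) := by
          rw [e4]; ring
      _ ≤ 16 * ((N : ℝ) ^ (12 / 5 : ℝ) * V⁻¹ ^ 4) * 1 := by
          refine mul_le_mul_of_nonneg_left ?_ (by positivity)
          rw [show V⁻¹ ^ 2 = (V ^ 2)⁻¹ by rw [inv_pow], ← div_eq_mul_inv, div_le_one hV0']
          exact hV2
      _ = 16 * ((N : ℝ) ^ (12 / 5 : ℝ) * V⁻¹ ^ 4) := mul_one _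
  have hfirst : ((N : ℝ) + 1) * (2 * N) * V⁻¹ ^ 2 ≤ 16 * ((N : ℝ) ^ 2 * V⁻¹ ^ 2) := by
    have : ((N : ℝ) + 1) * (2 * N) ≤ 16 * (N : ℝ) ^ 2 := by nlinarith
    calc ((N : ℝ) + 1) * (2 * N) * V⁻¹ ^ 2 ≤ (16 * (N : ℝ) ^ 2) * V⁻¹ ^ 2 :=
          mul_le_mul_of_nonneg_right this (by positivity)
      _ = 16 * ((N : ℝ) ^ 2 * V⁻¹ ^ 2) := by ring
  have hsecond : ((N : ℝ) + 1) ^ 3 * (2 * N) * T * V⁻¹ ^ 6 * Real.log (2 * N * T) ^ 4 ≤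
      16 * (T * (N : ℝ) ^ (12 / 5 : ℝ) * V⁻¹ ^ 4) * (1 + Real.log (2 * T ^ 2)) ^ 4 := by
    calc ((N : ℝ) + 1) ^ 3 * (2 * N) * T * V⁻¹ ^ 6 * Real.log (2 * N * T) ^ 4
        = (((N : ℝ) + 1) ^ 3 * (2 * N) * V⁻¹ ^ 6) * T * Real.log (2 * N * T) ^ 4 := by ring
      _ ≤ (16 * ((N : ℝ) ^ (12 / 5 : ℝ) * V⁻¹ ^ 4)) * T * (1 + Real.log (2 * T ^ 2)) ^ 4 := by
          refine mul_le_mul (mul_le_mul_of_nonneg_right hkey (by positivity)) hlogNT4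
            (by positivity) (by positivity)
      _ = 16 * (T * (N : ℝ) ^ (12 / 5 : ℝ) * V⁻¹ ^ 4) * (1 + Real.log (2 * T ^ 2)) ^ 4 := by ring
  have hl1 : (1 : ℝ) ≤ (1 + Real.log (2 * T ^ 2)) ^ 4 := by
    have : 0 ≤ Real.log (2 * T ^ 2) := Real.log_nonneg (by nlinarith)
    exact one_le_pow₀ (by linarith)
  have hin0 : 0 ≤ (N : ℝ) ^ 2 * V⁻¹ ^ 2 := by positivity
  calc (W.card : ℝ) ≤ _ := h
    _ ≤ C_h * (1 + Real.log (2 * T)) *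
        (16 * ((N : ℝ) ^ 2 * V⁻¹ ^ 2) + 16 * (T * (N : ℝ) ^ (12 / 5 : ℝ) * V⁻¹ ^ 4) *
          (1 + Real.log (2 * T ^ 2)) ^ 4) := by
        refine mul_le_mul (mul_le_mul_of_nonneg_left (by linarith) hCh0) (add_le_add hfirst hsecond)
          (by positivity) (by positivity)
    _ ≤ C_h * (1 + Real.log (2 * T)) *
        (16 * ((N : ℝ) ^ 2 * V⁻¹ ^ 2) * (1 + Real.log (2 * T ^ 2)) ^ 4 +
          16 * (T * (N : ℝ) ^ (12 / 5 : ℝ) * V⁻¹ ^ 4) * (1 + Real.log (2 * T ^ 2)) ^ 4) := by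
        refine mul_le_mul_of_nonneg_left (add_le_add ?_ le_rfl) (by positivity)
        exact le_mul_of_one_le_right (by positivity) hl1
    _ = 16 * C_h * ((1 + Real.log (2 * T)) * (1 + Real.log (2 * T ^ 2)) ^ 4) *
          ((N : ℝ) ^ 2 * V⁻¹ ^ 2 + T * (N : ℝ) ^ (12 / 5 : ℝ) * V⁻¹ ^ 4) := by ring

/-! ## §5. The grid in `σ` and the bound on one piece -/

/-- **A grid point below `log X/log N'`**: if `N' ≥ 2`, `Δ > 0` and `N'^{7/10} ≤ X ≤ N'^{4/5}`,
there is `j ≤ ⌊(1/10)/Δ⌋` with `σ_j = 7/10 + jΔ ≤ 4/5` and `N'^{σ_j} ≤ X ≤ N'^{σ_j + Δ}`. (The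
finitely many `σ_j` make the constants of Proposition 3.1 uniform over the values `V = N^σ`,
`σ ∈ [7/10, 8/10]`.) [cite: GuthMaynard2026, Section 3] -/
theorem sigma_grid {N' : ℕ} (hN' : 2 ≤ N') {X Δ : ℝ} (hΔ : 0 < Δ)
    (hX7 : (N' : ℝ) ^ (7 / 10 : ℝ) ≤ X) (hX8 : X ≤ (N' : ℝ) ^ (4 / 5 : ℝ)) :
    ∃ j : ℕ, j ≤ ⌊(1 / 10) / Δ⌋₊ ∧ 7 / 10 + j * Δ ≤ 4 / 5 ∧
      (N' : ℝ) ^ (7 / 10 + j * Δ) ≤ X ∧ X ≤ (N' : ℝ) ^ (7 / 10 + j * Δ + Δ) := by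
  have hN'1 : (1 : ℝ) < N' := by exact_mod_cast (by omega : 1 < N')
  have hN'0 : (0 : ℝ) < N' := by linarith
  have hlogN : 0 < Real.log N' := Real.log_pos hN'1
  have hX0 : 0 < X := lt_of_lt_of_le (by positivity) hX7
  set s : ℝ := Real.log X / Real.log N' with hs
  have hXs : (N' : ℝ) ^ s = X := by
    rw [Real.rpow_def_of_pos hN'0, hs, mul_div_cancel₀ _ hlogN.ne', Real.exp_log hX0]
  have hs7 : 7 / 10 ≤ s := by
    rw [← hXs] at hX7
    exact (Real.rpow_le_rpow_left_iff hN'1).1 hX7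
  have hs8 : s ≤ 4 / 5 := by
    rw [← hXs] at hX8
    exact (Real.rpow_le_rpow_left_iff hN'1).1 hX8
  set j : ℕ := ⌊(s - 7 / 10) / Δ⌋₊ with hj
  have hq0 : 0 ≤ (s - 7 / 10) / Δ := div_nonneg (by linarith) hΔ.le
  have hj1 : (j : ℝ) ≤ (s - 7 / 10) / Δ := Nat.floor_le hq0
  have hj2 : (s - 7 / 10) / Δ < j + 1 := Nat.lt_floor_add_one _
  rw [le_div_iff₀ hΔ] at hj1
  rw [div_lt_iff₀ hΔ] at hj2
  refine ⟨j, ?_, by linarith, ?_, ?_⟩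
  · exact Nat.floor_le_floor (div_le_div_of_nonneg_right (by linarith) hΔ.le)
  · rw [← hXs]; exact Real.rpow_le_rpow_of_exponent_le hN'1.le (by linarith)
  · rw [← hXs]; exact Real.rpow_le_rpow_of_exponent_le hN'1.le (by linarith)

/-- **The bound on one piece** (Guth–Maynard §3, the heart of the reduction: insert `w(n/N')`,
thin to a `T^η`-separated subset, subdivide `[0, T]` into intervals of length `N'^{6/5}`, apply
Proposition 3.1 on each, and convert `N'^{-4σ'}` into `V⁻⁴`). Let the coefficients `b` be
`1`-bounded, `P` a set of `n` with `6N' ≤ 5n ≤ 9N'`, `N'^{σ'} ≤ V/3 ≤ N'^{σ'+Δ}`, and suppose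
Proposition 3.1 holds at `(σ', ε₁, δ)` with constants `(C, N₀)`, `N₀ ≤ N'`, `(N'^{6/5})^{ε₁} ≤ S`,
`S ≥ 1`. Then a `1`-separated `W ⊂ [0, T]` with `|∑_{n∈P} b_n n^{it}| ≥ V/3` on `W` has
`#W ≤ 81 C (S + 2)(TN'^{12/5} + N'^{18/5}) N'^{4Δ+δ} V⁻⁴`. [cite: GuthMaynard2026, Section 3] -/
theorem piece_bound {w : ℝ → ℝ} (hw : ∀ u : ℝ, 6 / 5 ≤ u → u ≤ 9 / 5 → w u = 1)
    {T S δ Δ σ' C N₀ ε₁ V : ℝ} {N' : ℕ} {b : ℕ → ℂ} (P : Finset ℕ) (W : Finset ℝ)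
    (hT : 1 ≤ T) (hS1 : 1 ≤ S) (hN' : 1 ≤ N') (hC : 0 ≤ C)
    (hP : ∀ n ∈ P, 6 * N' ≤ 5 * n ∧ 5 * n ≤ 9 * N')
    (hb : ∀ n, ‖b n‖ ≤ 1) (hV : 0 < V)
    (hσV : (N' : ℝ) ^ σ' ≤ V / 3) (hVσ : V / 3 ≤ (N' : ℝ) ^ (σ' + Δ))
    (hN₀ : N₀ ≤ (N' : ℝ)) (hSL : (((N' : ℝ) ^ (6 / 5 : ℝ)) ^ ε₁) ≤ S)
    (hKPσ : ∀ M : ℕ, N₀ ≤ (M : ℝ) → ∀ (a : ℕ → ℂ) (t₀ : ℝ) (W'' : Finset ℝ), (∀ n, ‖a n‖ ≤ 1) →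
      (∀ t ∈ W'', t₀ ≤ t ∧ t ≤ t₀ + (M : ℝ) ^ (6 / 5 : ℝ)) →
      (∀ t ∈ W'', ∀ t' ∈ W'', t ≠ t' → ((M : ℝ) ^ (6 / 5 : ℝ)) ^ ε₁ ≤ |t - t'|) →
      (∀ t ∈ W'', (M : ℝ) ^ σ' ≤ ‖∑ n ∈ Finset.Icc M (2 * M), ((w ((n : ℝ) / M) : ℝ) : ℂ) * a n *
        (n : ℂ) ^ ((t : ℂ) * I)‖) →
      (W''.card : ℝ) ≤ C * (M : ℝ) ^ (6 / 5 : ℝ) * (M : ℝ) ^ ((12 - 20 * σ') / 5 + δ))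
    (hW : ∀ t ∈ W, 0 ≤ t ∧ t ≤ T) (hsep : ∀ t ∈ W, ∀ t' ∈ W, t ≠ t' → 1 ≤ |t - t'|)
    (hlargeP : ∀ t ∈ W, V / 3 ≤ ‖∑ n ∈ P, b n * (n : ℂ) ^ ((t : ℂ) * I)‖) :
    (W.card : ℝ) ≤ 81 * C * (S + 2) *
      ((T * (N' : ℝ) ^ (12 / 5 : ℝ) + (N' : ℝ) ^ (18 / 5 : ℝ)) * (N' : ℝ) ^ (4 * Δ + δ) * V⁻¹ ^ 4) := by
  classical
  have hN'0 : (0 : ℝ) < N' := by exact_mod_cast hN'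
  have hT0 : 0 ≤ T := by linarith
  set L : ℝ := (N' : ℝ) ^ (6 / 5 : ℝ) with hL
  have hL0 : 0 < L := by positivity
  set a : ℕ → ℂ := fun n ↦ if n ∈ P then b n else 0 with ha
  have ha1 : ∀ n, ‖a n‖ ≤ 1 := by
    intro n; rw [ha]; dsimp only
    split_ifs
    · exact hb n
    · simp
  set B : ℝ := C * L * (N' : ℝ) ^ ((12 - 20 * σ') / 5 + δ) with hB
  have hB0 : 0 ≤ B := by positivity
  -- Proposition 3.1 on a short interval
  have hshort : ∀ (t₀ : ℝ), ∀ W' ⊆ W, (∀ t ∈ W', t₀ ≤ t ∧ t ≤ t₀ + L) →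
      (∀ t ∈ W', ∀ t' ∈ W', t ≠ t' → S ≤ |t - t'|) → (W'.card : ℝ) ≤ B := by
    intro t₀ W' hW'W hI hsepS
    refine hKPσ N' hN₀ a t₀ W' ha1 hI (fun t ht t' ht' hne ↦ hSL.trans (hsepS t ht t' ht' hne)) ?_
    intro t ht
    have e : ∑ n ∈ Finset.Icc N' (2 * N'), ((w ((n : ℝ) / N') : ℝ) : ℂ) * a n * (n : ℂ) ^ ((t : ℂ) * I) =
        ∑ n ∈ P, b n * (n : ℂ) ^ ((t : ℂ) * I) := by
      rw [ha]; exact sum_weight_indicator_eq hw hN' P hP b t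
    rw [e]
    exact hσV.trans (hlargeP t (hW'W ht))
  have hcount := card_le_of_sep_of_short hT0 hL0 hS1 hB0 W hW hsep hshort
  -- `(T/L + 1) B = C (T + L) N'^{…}`
  have e1 : (T / L + 1) * B = C * ((T + L) * (N' : ℝ) ^ ((12 - 20 * σ') / 5 + δ)) := by
    rw [hB]; field_simp
  -- `N'^{(12−20σ')/5+δ} = N'^{12/5} N'^{−4σ'} N'^{δ}`
  have e2 : (N' : ℝ) ^ ((12 - 20 * σ') / 5 + δ) =
      (N' : ℝ) ^ (12 / 5 : ℝ) * (N' : ℝ) ^ (-(4 * σ')) * (N' : ℝ) ^ δ := by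
    rw [← Real.rpow_add hN'0, ← Real.rpow_add hN'0]; ring_nf
  -- `N'^{−4σ'} ≤ 81 N'^{4Δ} V⁻⁴`
  have hV3 : 0 < V / 3 := by positivity
  have e3 : (N' : ℝ) ^ (-(4 * σ')) ≤ 81 * ((N' : ℝ) ^ (4 * Δ) * V⁻¹ ^ 4) := by
    have h1 : (V / 3) ^ 4 ≤ ((N' : ℝ) ^ (σ' + Δ)) ^ 4 := pow_le_pow_left₀ hV3.le hVσ 4
    have h2 : ((N' : ℝ) ^ (σ' + Δ)) ^ 4 = (N' : ℝ) ^ (4 * σ' + 4 * Δ) := by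
      rw [← Real.rpow_natCast ((N' : ℝ) ^ (σ' + Δ)), ← Real.rpow_mul hN'0.le]; ring_nf
    rw [h2] at h1
    have h3 : ((N' : ℝ) ^ (4 * σ' + 4 * Δ))⁻¹ ≤ ((V / 3) ^ 4)⁻¹ := by
      rw [inv_le_inv₀ (by positivity) (by positivity)]; exact h1
    have e4 : (N' : ℝ) ^ (-(4 * σ')) = (N' : ℝ) ^ (4 * Δ) * ((N' : ℝ) ^ (4 * σ' + 4 * Δ))⁻¹ := by
      rw [← Real.rpow_neg hN'0.le, ← Real.rpow_add hN'0]; ring_nf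
    have e5 : ((V / 3) ^ 4)⁻¹ = 81 * V⁻¹ ^ 4 := by
      rw [div_pow, inv_div, inv_pow]; norm_num; rw [div_eq_mul_inv]
    rw [e4]
    calc (N' : ℝ) ^ (4 * Δ) * ((N' : ℝ) ^ (4 * σ' + 4 * Δ))⁻¹
        ≤ (N' : ℝ) ^ (4 * Δ) * ((V / 3) ^ 4)⁻¹ := mul_le_mul_of_nonneg_left h3 (by positivity)
      _ = 81 * ((N' : ℝ) ^ (4 * Δ) * V⁻¹ ^ 4) := by rw [e5]; ring
  have e6 : (T + L) * (N' : ℝ) ^ (12 / 5 : ℝ) = T * (N' : ℝ) ^ (12 / 5 : ℝ) + (N' : ℝ) ^ (18 / 5 : ℝ) := by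
    rw [hL, add_mul, ← Real.rpow_add hN'0]; norm_num
  have e7 : (N' : ℝ) ^ (4 * Δ) * (N' : ℝ) ^ δ = (N' : ℝ) ^ (4 * Δ + δ) := by
    rw [← Real.rpow_add hN'0]
  have hposA : 0 ≤ (T + L) * (N' : ℝ) ^ (12 / 5 : ℝ) := by positivity
  calc (W.card : ℝ) ≤ (S + 2) * ((T / L + 1) * B) := hcount
    _ = (S + 2) * (C * ((T + L) * (N' : ℝ) ^ ((12 - 20 * σ') / 5 + δ))) := by rw [e1]
    _ = (S + 2) * C * (((T + L) * (N' : ℝ) ^ (12 / 5 : ℝ)) * (N' : ℝ) ^ (-(4 * σ')) * (N' : ℝ) ^ δ) := by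
        rw [e2]; ring
    _ ≤ (S + 2) * C * (((T + L) * (N' : ℝ) ^ (12 / 5 : ℝ)) * (81 * ((N' : ℝ) ^ (4 * Δ) * V⁻¹ ^ 4)) *
          (N' : ℝ) ^ δ) := by
        refine mul_le_mul_of_nonneg_left ?_ (by positivity)
        refine mul_le_mul_of_nonneg_right (mul_le_mul_of_nonneg_left e3 hposA) (by positivity)
    _ = 81 * C * (S + 2) * (((T + L) * (N' : ℝ) ^ (12 / 5 : ℝ)) *
          ((N' : ℝ) ^ (4 * Δ) * (N' : ℝ) ^ δ) * V⁻¹ ^ 4) := by ring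
    _ = 81 * C * (S + 2) *
          ((T * (N' : ℝ) ^ (12 / 5 : ℝ) + (N' : ℝ) ^ (18 / 5 : ℝ)) * (N' : ℝ) ^ (4 * Δ + δ) * V⁻¹ ^ 4) := by
        rw [e6, e7]

/-! ## §6. Theorem 1.1 from Proposition 3.1 -/

set_option maxHeartbeats 1600000 in
/-- **Guth–Maynard's Theorem 1.1 from their Proposition 3.1** (§3 of the paper, "Proof of
Theorem 1.1 assuming Proposition 3.1"). Let `w : ℝ → ℝ` be `1` on `[6/5, 9/5]`, and suppose
Proposition 3.1 holds for `w`: for `σ ∈ [7/10, 8/10]`, `ε > 0` (and every `δ > 0`, for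
`N ≥ N₀(σ, ε, δ)`), every `1`-bounded `(b_n)` and every set `W` of `T^ε`-separated points in an
interval of length `T = N^{6/5}` with `|∑_n w(n/N) b_n n^{it}| ≥ N^σ` on `W` has
`|W| ≤ C T N^{(12−20σ)/5+δ}`. Then Theorem 1.1 holds in the form used by
`zeroDensity_guth_maynard_of_largeValues`: for every `ε > 0` there are `C, T₀` such that for
`T ≥ T₀`, `1 ≤ N ≤ T`, `|b_n| ≤ 1`, and a `1`-separated `W ⊂ [0, T]` with
`|∑_{n=N}^{2N} b_n n^{it}| ≥ V > 0` on `W`, `#W ≤ C T^ε (N²V⁻² + N^{18/5}V⁻⁴ + TN^{12/5}V⁻⁴)`.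
The proof is the paper's: `V ≤ 4N^{7/10}` and `V ≥ N^{4/5}` by the classical estimate (1.1)
(`largeValues_smallV`, `largeValues_largeV`, from the tree's mean value theorem and Huxley's
large values theorem); otherwise split `[N, 2N]` into three pieces, insert `w(n/N')`
(`N' = ⌊5N/6⌋, N, ⌈10N/9⌉`), thin to `T^η`-separated subsets, subdivide `[0, T]` into intervals
of length `N'^{6/5}` and apply Proposition 3.1 on each (`piece_bound`); the constants are made
uniform over `V = N'^σ` by a finite grid in `σ` (`sigma_grid`). [cite: GuthMaynard2026, Section 3] -/
theorem largeValues_of_keyProp {w : ℝ → ℝ} (hw : ∀ u : ℝ, 6 / 5 ≤ u → u ≤ 9 / 5 → w u = 1)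
    (hKP : ∀ σ : ℝ, 7 / 10 ≤ σ → σ ≤ 4 / 5 → ∀ ε : ℝ, 0 < ε → ∀ δ : ℝ, 0 < δ →
      ∃ C N₀ : ℝ, ∀ N : ℕ, N₀ ≤ (N : ℝ) → ∀ (b : ℕ → ℂ) (t₀ : ℝ) (W : Finset ℝ),
      (∀ n, ‖b n‖ ≤ 1) → (∀ t ∈ W, t₀ ≤ t ∧ t ≤ t₀ + (N : ℝ) ^ (6 / 5 : ℝ)) →
      (∀ t ∈ W, ∀ t' ∈ W, t ≠ t' → ((N : ℝ) ^ (6 / 5 : ℝ)) ^ ε ≤ |t - t'|) →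
      (∀ t ∈ W, (N : ℝ) ^ σ ≤ ‖∑ n ∈ Finset.Icc N (2 * N), ((w ((n : ℝ) / N) : ℝ) : ℂ) * b n *
        (n : ℂ) ^ ((t : ℂ) * I)‖) →
      (W.card : ℝ) ≤ C * (N : ℝ) ^ (6 / 5 : ℝ) * (N : ℝ) ^ ((12 - 20 * σ) / 5 + δ)) :
    ∀ ε : ℝ, 0 < ε → ∃ C T₀ : ℝ, ∀ T : ℝ, T₀ ≤ T →
      ∀ (N : ℕ) (b : ℕ → ℂ) (V : ℝ) (W : Finset ℝ), 1 ≤ N → (N : ℝ) ≤ T →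
      (∀ n, ‖b n‖ ≤ 1) → 0 < V → (∀ t ∈ W, 0 ≤ t ∧ t ≤ T) →
      (∀ t ∈ W, ∀ t' ∈ W, t ≠ t' → 1 ≤ |t - t'|) →
      (∀ t ∈ W, V ≤ ‖∑ n ∈ Finset.Icc N (2 * N), b n * (n : ℂ) ^ ((t : ℂ) * I)‖) →
      (W.card : ℝ) ≤ C * T ^ ε * ((N : ℝ) ^ 2 * V⁻¹ ^ 2 + (N : ℝ) ^ (18 / 5 : ℝ) * V⁻¹ ^ 4 +
        T * (N : ℝ) ^ (12 / 5 : ℝ) * V⁻¹ ^ 4) := by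
  intro ε hε
  classical
  -- ### parameters
  set ε' : ℝ := min ε 1 with hε'
  have hε'0 : 0 < ε' := lt_min hε one_pos
  have hε'ε : ε' ≤ ε := min_le_left _ _
  have hε'1 : ε' ≤ 1 := min_le_right _ _
  set η : ℝ := ε' / 4 with hη
  set δ : ℝ := ε' / 4 with hδ
  set Δ : ℝ := ε' / 16 with hΔ
  set ε₁ : ℝ := 5 * η / 12 with hε₁
  have hη0 : 0 < η := by positivity
  have hδ0 : 0 < δ := by positivity
  have hΔ0 : 0 < Δ := by positivity
  have hε₁0 : 0 < ε₁ := by positivity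
  set J₀ : ℕ := ⌊(1 / 10) / Δ⌋₊ with hJ₀
  -- ### Proposition 3.1 on the grid `σ_j = 7/10 + jΔ`
  have hKPj : ∀ j : ℕ, ∃ C N₀ : ℝ, 0 ≤ C ∧ 0 ≤ N₀ ∧ (7 / 10 + (j : ℝ) * Δ ≤ 4 / 5 →
      ∀ M : ℕ, N₀ ≤ (M : ℝ) → ∀ (a : ℕ → ℂ) (t₀ : ℝ) (W'' : Finset ℝ), (∀ n, ‖a n‖ ≤ 1) →
      (∀ t ∈ W'', t₀ ≤ t ∧ t ≤ t₀ + (M : ℝ) ^ (6 / 5 : ℝ)) →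
      (∀ t ∈ W'', ∀ t' ∈ W'', t ≠ t' → ((M : ℝ) ^ (6 / 5 : ℝ)) ^ ε₁ ≤ |t - t'|) →
      (∀ t ∈ W'', (M : ℝ) ^ (7 / 10 + (j : ℝ) * Δ) ≤ ‖∑ n ∈ Finset.Icc M (2 * M),
        ((w ((n : ℝ) / M) : ℝ) : ℂ) * a n * (n : ℂ) ^ ((t : ℂ) * I)‖) →
      (W''.card : ℝ) ≤ C * (M : ℝ) ^ (6 / 5 : ℝ) *
        (M : ℝ) ^ ((12 - 20 * (7 / 10 + (j : ℝ) * Δ)) / 5 + δ)) := by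
    intro j
    by_cases hj : 7 / 10 + (j : ℝ) * Δ ≤ 4 / 5
    · have hj0 : (0 : ℝ) ≤ j * Δ := by positivity
      obtain ⟨C, N₀, hC⟩ := hKP (7 / 10 + j * Δ) (by linarith) hj ε₁ hε₁0 δ hδ0
      refine ⟨max C 0, max N₀ 0, le_max_right _ _, le_max_right _ _,
        fun _ M hM a t₀ W'' ha hI hS hL ↦ ?_⟩
      have h := hC M ((le_max_left _ _).trans hM) a t₀ W'' ha hI hS hL
      exact h.trans (mul_le_mul_of_nonneg_right
        (mul_le_mul_of_nonneg_right (le_max_left _ _) (by positivity)) (by positivity))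
    · exact ⟨0, 0, le_rfl, le_rfl, fun h ↦ absurd h hj⟩
  choose Cf Nf hCf0 hNf0 hKPf using hKPj
  set C_max : ℝ := ∑ j ∈ Finset.range (J₀ + 1), Cf j with hCmax
  set N_max : ℝ := ∑ j ∈ Finset.range (J₀ + 1), Nf j with hNmax
  have hCmax0 : 0 ≤ C_max := Finset.sum_nonneg fun j _ ↦ hCf0 j
  have hNmax0 : 0 ≤ N_max := Finset.sum_nonneg fun j _ ↦ hNf0 j
  have hCfle : ∀ j, j ≤ J₀ → Cf j ≤ C_max := fun j hj ↦
    Finset.single_le_sum (fun i _ ↦ hCf0 i) (Finset.mem_range.2 (by omega))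
  have hNfle : ∀ j, j ≤ J₀ → Nf j ≤ N_max := fun j hj ↦
    Finset.single_le_sum (fun i _ ↦ hNf0 i) (Finset.mem_range.2 (by omega))
  -- the classical constant
  obtain ⟨C_h, hCh0, hCh⟩ := largeValues_hmh
  -- ### the constants
  set N_min : ℝ := 2 * N_max + 10 with hNmin
  set K₁ : ℝ := 1408 * (3 / ε') with hK₁
  set K₂ : ℝ := 16 * C_h * (768 * (((5 : ℕ) : ℝ) / ε') ^ 5) with hK₂
  set K₃ : ℝ := 2 * N_min with hK₃
  set K₄ : ℝ := 3 * (7776 * C_max) with hK₄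
  have hK₁0 : 0 ≤ K₁ := by positivity
  have hK₂0 : 0 ≤ K₂ := by positivity
  have hK₃0 : 0 ≤ K₃ := by positivity
  have hK₄0 : 0 ≤ K₄ := by positivity
  refine ⟨K₁ + K₂ + K₃ + K₄, 3, fun T hT N b V W hN hNT hb hV hW hsep hlarge ↦ ?_⟩
  -- ### basic facts
  have hT1 : 1 ≤ T := by linarith
  have hT0 : 0 < T := by linarith
  have hN0 : (0 : ℝ) < N := by exact_mod_cast hN
  have hN1 : (1 : ℝ) ≤ N := by exact_mod_cast hN
  set pa : ℝ := (N : ℝ) ^ 2 * V⁻¹ ^ 2 with hpa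
  set pb : ℝ := (N : ℝ) ^ (18 / 5 : ℝ) * V⁻¹ ^ 4 with hpb
  set pc : ℝ := T * (N : ℝ) ^ (12 / 5 : ℝ) * V⁻¹ ^ 4 with hpc'
  have hpa0 : 0 ≤ pa := by positivity
  have hpb0 : 0 ≤ pb := by positivity
  have hpc0 : 0 ≤ pc := by positivity
  have hTε : T ^ ε' ≤ T ^ ε := Real.rpow_le_rpow_of_exponent_le hT1 hε'ε
  have hTε1 : 1 ≤ T ^ ε' := Real.one_le_rpow hT1 hε'0.le
  have hTε0 : 0 ≤ T ^ ε := by positivity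
  -- logarithms
  have hlT1 : 1 ≤ Real.log T := by
    rw [Real.le_log_iff_exp_le hT0]; linarith [Real.exp_one_lt_d9]
  have hlog2 : Real.log 2 ≤ 1 := by linarith [Real.log_two_lt_d9]
  have hlog2T : 1 + Real.log (2 * T) ≤ 3 * Real.log T := by
    rw [Real.log_mul (by norm_num) hT0.ne']; linarith
  have hlog2T2 : 1 + Real.log (2 * T ^ 2) ≤ 4 * Real.log T := by
    rw [Real.log_mul (by norm_num) (by positivity), Real.log_pow]; push_cast; linarith
  have hlogε : Real.log T ≤ T ^ ε' / ε' := Real.log_le_rpow_div hT0.le hε'0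
  have hlog5 : Real.log T ^ 5 ≤ (((5 : ℕ) : ℝ) / ε') ^ 5 * T ^ ε' :=
    HuxleyIvic.log_pow_le hT1 hε'0 (p := 5) (by norm_num)
  -- the final form of a bound `≤ K T^{ε'} (…)`
  have hfinal : ∀ {K X : ℝ}, 0 ≤ K → K ≤ K₁ + K₂ + K₃ + K₄ → X ≤ pa + pb + pc →
      (W.card : ℝ) ≤ K * T ^ ε' * X → (W.card : ℝ) ≤ (K₁ + K₂ + K₃ + K₄) * T ^ ε * (pa + pb + pc) := by
    intro K X hK0 hKle hX h
    have hWn : (0 : ℝ) ≤ W.card := Nat.cast_nonneg _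
    rcases le_or_gt X 0 with hX0 | hX0
    · have : K * T ^ ε' * X ≤ 0 := mul_nonpos_of_nonneg_of_nonpos (by positivity) hX0
      have h0 : (W.card : ℝ) ≤ 0 := h.trans this
      exact h0.trans (by positivity)
    · calc (W.card : ℝ) ≤ K * T ^ ε' * X := h
        _ ≤ (K₁ + K₂ + K₃ + K₄) * T ^ ε * (pa + pb + pc) := by
            refine mul_le_mul (mul_le_mul hKle hTε (by positivity) (by positivity)) hX hX0.le
              (by positivity)
  -- ### the cases
  rcases le_or_gt V (4 * (N : ℝ) ^ (7 / 10 : ℝ)) with hVs | hVs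
  · -- small `V`
    have h := largeValues_smallV hT1 hN hNT hb hV hVs W hW hsep hlarge
    refine hfinal hK₁0 (by linarith) (show pc ≤ pa + pb + pc by linarith) ?_
    calc (W.card : ℝ) ≤ 1408 * (1 + Real.log (2 * T)) * pc := h
      _ ≤ 1408 * (3 * (T ^ ε' / ε')) * pc := by
          refine mul_le_mul_of_nonneg_right (mul_le_mul_of_nonneg_left ?_ (by norm_num)) hpc0
          exact hlog2T.trans (by linarith)
      _ = K₁ * T ^ ε' * pc := by rw [hK₁]; field_simp
  rcases le_or_gt ((N : ℝ) ^ (4 / 5 : ℝ)) V with hVl | hVl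
  · -- large `V`
    have h := largeValues_largeV hCh0 hCh hT1 hN hNT hb hV hVl W hW hsep hlarge
    refine hfinal hK₂0 (by linarith) (show pa + pc ≤ pa + pb + pc by linarith) ?_
    have hl0 : 0 ≤ Real.log T := by linarith
    have hlogs : (1 + Real.log (2 * T)) * (1 + Real.log (2 * T ^ 2)) ^ 4 ≤ 768 * Real.log T ^ 5 := by
      have h1 : (1 + Real.log (2 * T ^ 2)) ^ 4 ≤ (4 * Real.log T) ^ 4 :=
        pow_le_pow_left₀ (by linarith [Real.log_nonneg (show (1:ℝ) ≤ 2 * T ^ 2 by nlinarith)]) hlog2T2 4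
      have h0 : 0 ≤ 1 + Real.log (2 * T) := by linarith [Real.log_nonneg (show (1:ℝ) ≤ 2 * T by linarith)]
      calc (1 + Real.log (2 * T)) * (1 + Real.log (2 * T ^ 2)) ^ 4
          ≤ (3 * Real.log T) * (4 * Real.log T) ^ 4 := mul_le_mul hlog2T h1 (by positivity) (by positivity)
        _ = 768 * Real.log T ^ 5 := by ring
    calc (W.card : ℝ) ≤ 16 * C_h * ((1 + Real.log (2 * T)) * (1 + Real.log (2 * T ^ 2)) ^ 4) * (pa + pc) := h
      _ ≤ 16 * C_h * (768 * ((((5 : ℕ) : ℝ) / ε') ^ 5 * T ^ ε')) * (pa + pc) := by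
          refine mul_le_mul_of_nonneg_right (mul_le_mul_of_nonneg_left ?_ (by positivity)) (by positivity)
          exact hlogs.trans (by nlinarith [hlog5])
      _ = K₂ * T ^ ε' * (pa + pc) := by rw [hK₂]; ring
  -- middle `V`
  rcases lt_or_ge (N : ℝ) N_min with hNs | hNl
  · -- few `N`: the trivial count
    have hcard := card_le_of_one_sep hT0.le W hW hsep
    refine hfinal hK₃0 (by linarith) (show pc ≤ pa + pb + pc by linarith) ?_
    -- `T ≤ N_min · pc`
    have hNmin1 : 1 ≤ N_min := by rw [hNmin]; linarith
    have hV45 : V⁻¹ ^ 4 ≥ ((N : ℝ) ^ (4 / 5 : ℝ))⁻¹ ^ 4 := by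
      have : V⁻¹ ≥ ((N : ℝ) ^ (4 / 5 : ℝ))⁻¹ := by
        rw [ge_iff_le, inv_le_inv₀ (by positivity) hV]; exact hVl.le
      exact pow_le_pow_left₀ (by positivity) this 4
    have e1 : (N : ℝ) ^ (12 / 5 : ℝ) * ((N : ℝ) ^ (4 / 5 : ℝ))⁻¹ ^ 4 = ((N : ℝ) ^ (4 / 5 : ℝ))⁻¹ := by
      rw [← Real.rpow_neg hN0.le, ← Real.rpow_natCast, ← Real.rpow_mul hN0.le, ← Real.rpow_add hN0]
      norm_num
    have hN45 : ((N : ℝ) ^ (4 / 5 : ℝ))⁻¹ ≥ (N : ℝ)⁻¹ := by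
      rw [ge_iff_le, inv_le_inv₀ hN0 (by positivity)]
      calc (N : ℝ) ^ (4 / 5 : ℝ) ≤ (N : ℝ) ^ (1 : ℝ) := Real.rpow_le_rpow_of_exponent_le hN1 (by norm_num)
        _ = N := Real.rpow_one _
    have hNinv : (N : ℝ)⁻¹ ≥ N_min⁻¹ := by
      rw [ge_iff_le, inv_le_inv₀ (by linarith) hN0]; exact hNs.le
    have hpc_low : T * N_min⁻¹ ≤ pc := by
      rw [hpc']
      calc T * N_min⁻¹ ≤ T * ((N : ℝ) ^ (4 / 5 : ℝ))⁻¹ :=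
            mul_le_mul_of_nonneg_left (hNinv.le.trans hN45.le) hT0.le
        _ = T * ((N : ℝ) ^ (12 / 5 : ℝ) * ((N : ℝ) ^ (4 / 5 : ℝ))⁻¹ ^ 4) := by rw [e1]
        _ ≤ T * ((N : ℝ) ^ (12 / 5 : ℝ) * V⁻¹ ^ 4) :=
            mul_le_mul_of_nonneg_left (mul_le_mul_of_nonneg_left hV45.le (by positivity)) hT0.le
        _ = T * (N : ℝ) ^ (12 / 5 : ℝ) * V⁻¹ ^ 4 := by ring
    have hTpc : T ≤ N_min * pc := by
      calc T = N_min * (T * N_min⁻¹) := by field_simp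
        _ ≤ N_min * pc := mul_le_mul_of_nonneg_left hpc_low (by linarith)
    calc (W.card : ℝ) ≤ T + 1 := hcard
      _ ≤ 2 * T := by linarith
      _ ≤ 2 * (N_min * pc) := by linarith
      _ = K₃ * 1 * pc := by rw [hK₃]; ring
      _ ≤ K₃ * T ^ ε' * pc := by gcongr
  · -- ### the three pieces
    have hN10r : (10 : ℝ) ≤ N := by rw [hNmin] at hNl; linarith
    have hN10 : 10 ≤ N := by exact_mod_cast hN10r
    -- the generic piece
    have hpiece : ∀ (P : Finset ℕ) (N' : ℕ), (∀ n ∈ P, 6 * N' ≤ 5 * n ∧ 5 * n ≤ 9 * N') →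
        2 * N ≤ 3 * N' + 3 → 5 * N' ≤ 6 * N →
        ((W.filter (fun t : ℝ ↦ V / 3 ≤ ‖∑ n ∈ P, b n * (n : ℂ) ^ ((t : ℂ) * I)‖)).card : ℝ) ≤
          7776 * C_max * T ^ ε' * (pb + pc) := by
      intro P N' hP h23 h56
      have h23r : 2 * (N : ℝ) ≤ 3 * N' + 3 := by exact_mod_cast h23
      have h56r : 5 * (N' : ℝ) ≤ 6 * N := by exact_mod_cast h56
      have hN'5 : (5 : ℝ) ≤ N' := by linarith
      have hN'2 : 2 ≤ N' := by
        have : (2 : ℝ) ≤ N' := by linarith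
        exact_mod_cast this
      have hN'1 : 1 ≤ N' := by omega
      have hN'0 : (0 : ℝ) < N' := by linarith
      have hN'le : (N' : ℝ) ≤ 6 / 5 * N := by linarith
      have hN'2N : (N' : ℝ) ≤ 2 * N := by linarith
      have hN3N' : (N : ℝ) ≤ 3 * N' := by linarith
      have hNmaxN' : N_max ≤ (N' : ℝ) := by rw [hNmin] at hNl; linarith
      -- the window for `σ`
      have hX7 : (N' : ℝ) ^ (7 / 10 : ℝ) ≤ V / 3 := by
        have h1 : (N' : ℝ) ^ (7 / 10 : ℝ) ≤ (6 / 5 * (N : ℝ)) ^ (7 / 10 : ℝ) :=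
          Real.rpow_le_rpow hN'0.le hN'le (by norm_num)
        have h2 : (6 / 5 * (N : ℝ)) ^ (7 / 10 : ℝ) = (6 / 5 : ℝ) ^ (7 / 10 : ℝ) * (N : ℝ) ^ (7 / 10 : ℝ) :=
          Real.mul_rpow (by norm_num) hN0.le
        have h3 : (6 / 5 : ℝ) ^ (7 / 10 : ℝ) ≤ 6 / 5 := by
          calc (6 / 5 : ℝ) ^ (7 / 10 : ℝ) ≤ (6 / 5 : ℝ) ^ (1 : ℝ) :=
                Real.rpow_le_rpow_of_exponent_le (by norm_num) (by norm_num)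
            _ = 6 / 5 := Real.rpow_one _
        have h4 : 0 ≤ (N : ℝ) ^ (7 / 10 : ℝ) := by positivity
        have h5 : (6 / 5 : ℝ) ^ (7 / 10 : ℝ) * (N : ℝ) ^ (7 / 10 : ℝ) ≤ 6 / 5 * (N : ℝ) ^ (7 / 10 : ℝ) :=
          mul_le_mul_of_nonneg_right h3 h4
        linarith
      have hX8 : V / 3 ≤ (N' : ℝ) ^ (4 / 5 : ℝ) := by
        have h1 : (N : ℝ) ^ (4 / 5 : ℝ) ≤ (3 * (N' : ℝ)) ^ (4 / 5 : ℝ) :=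
          Real.rpow_le_rpow hN0.le hN3N' (by norm_num)
        have h2 : (3 * (N' : ℝ)) ^ (4 / 5 : ℝ) = (3 : ℝ) ^ (4 / 5 : ℝ) * (N' : ℝ) ^ (4 / 5 : ℝ) :=
          Real.mul_rpow (by norm_num) hN'0.le
        have h3 : (3 : ℝ) ^ (4 / 5 : ℝ) ≤ 3 := by
          calc (3 : ℝ) ^ (4 / 5 : ℝ) ≤ (3 : ℝ) ^ (1 : ℝ) :=
                Real.rpow_le_rpow_of_exponent_le (by norm_num) (by norm_num)
            _ = 3 := Real.rpow_one _
        have h4 : 0 ≤ (N' : ℝ) ^ (4 / 5 : ℝ) := by positivity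
        have h5 : (3 : ℝ) ^ (4 / 5 : ℝ) * (N' : ℝ) ^ (4 / 5 : ℝ) ≤ 3 * (N' : ℝ) ^ (4 / 5 : ℝ) :=
          mul_le_mul_of_nonneg_right h3 h4
        linarith
      obtain ⟨j, hjJ, hσj, hlo, hhi⟩ := sigma_grid hN'2 hΔ0 hX7 hX8
      -- the separation after thinning
      have hS1 : 1 ≤ T ^ η := Real.one_le_rpow hT1 hη0.le
      have hSL : (((N' : ℝ) ^ (6 / 5 : ℝ)) ^ ε₁) ≤ T ^ η := by
        have h1 : (N' : ℝ) ≤ T ^ (2 : ℝ) := by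
          have : (N' : ℝ) ≤ 2 * T := by linarith
          have h2 : 2 * T ≤ T ^ (2 : ℝ) := by rw [Real.rpow_two]; nlinarith
          linarith
        have h2 : (N' : ℝ) ^ (6 / 5 : ℝ) ≤ (T ^ (2 : ℝ)) ^ (6 / 5 : ℝ) :=
          Real.rpow_le_rpow hN'0.le h1 (by norm_num)
        calc (((N' : ℝ) ^ (6 / 5 : ℝ)) ^ ε₁) ≤ ((T ^ (2 : ℝ)) ^ (6 / 5 : ℝ)) ^ ε₁ :=
              Real.rpow_le_rpow (by positivity) h2 hε₁0.le
          _ = T ^ η := by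
              rw [← Real.rpow_mul hT0.le, ← Real.rpow_mul hT0.le, hε₁]; ring_nf
      -- the filtered set
      set WP := W.filter (fun t : ℝ ↦ V / 3 ≤ ‖∑ n ∈ P, b n * (n : ℂ) ^ ((t : ℂ) * I)‖) with hWPdef
      have hWPmem : ∀ t ∈ WP, 0 ≤ t ∧ t ≤ T := fun t ht ↦ by
        rw [hWPdef, Finset.mem_filter] at ht; exact hW t ht.1
      have hsepP : ∀ t ∈ WP, ∀ t' ∈ WP, t ≠ t' → 1 ≤ |t - t'| := fun t ht t' ht' hne ↦ by
        rw [hWPdef, Finset.mem_filter] at ht ht'; exact hsep t ht.1 t' ht'.1 hne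
      have hlargeP : ∀ t ∈ WP, V / 3 ≤ ‖∑ n ∈ P, b n * (n : ℂ) ^ ((t : ℂ) * I)‖ := fun t ht ↦ by
        rw [hWPdef, Finset.mem_filter] at ht; exact ht.2
      have hpbd := piece_bound hw P WP hT1 hS1 hN'1 (hCf0 j) hP hb hV hlo hhi
        ((hNfle j hjJ).trans hNmaxN') hSL (hKPf j hσj) hWPmem hsepP hlargeP
      -- ### simplifying the bound
      have hCj : Cf j ≤ C_max := hCfle j hjJ
      have hS3 : T ^ η + 2 ≤ 3 * T ^ η := by linarith
      have h12 : (N' : ℝ) ^ (12 / 5 : ℝ) ≤ 8 * (N : ℝ) ^ (12 / 5 : ℝ) := by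
        calc (N' : ℝ) ^ (12 / 5 : ℝ) ≤ (2 * (N : ℝ)) ^ (12 / 5 : ℝ) :=
              Real.rpow_le_rpow hN'0.le hN'2N (by norm_num)
          _ = (2 : ℝ) ^ (12 / 5 : ℝ) * (N : ℝ) ^ (12 / 5 : ℝ) := Real.mul_rpow (by norm_num) hN0.le
          _ ≤ 8 * (N : ℝ) ^ (12 / 5 : ℝ) := by
              refine mul_le_mul_of_nonneg_right ?_ (by positivity)
              calc (2 : ℝ) ^ (12 / 5 : ℝ) ≤ (2 : ℝ) ^ (3 : ℝ) :=
                    Real.rpow_le_rpow_of_exponent_le (by norm_num) (by norm_num)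
                _ = 8 := by norm_num
      have h18 : (N' : ℝ) ^ (18 / 5 : ℝ) ≤ 16 * (N : ℝ) ^ (18 / 5 : ℝ) := by
        calc (N' : ℝ) ^ (18 / 5 : ℝ) ≤ (2 * (N : ℝ)) ^ (18 / 5 : ℝ) :=
              Real.rpow_le_rpow hN'0.le hN'2N (by norm_num)
          _ = (2 : ℝ) ^ (18 / 5 : ℝ) * (N : ℝ) ^ (18 / 5 : ℝ) := Real.mul_rpow (by norm_num) hN0.le
          _ ≤ 16 * (N : ℝ) ^ (18 / 5 : ℝ) := by
              refine mul_le_mul_of_nonneg_right ?_ (by positivity)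
              calc (2 : ℝ) ^ (18 / 5 : ℝ) ≤ (2 : ℝ) ^ (4 : ℝ) :=
                    Real.rpow_le_rpow_of_exponent_le (by norm_num) (by norm_num)
                _ = 16 := by norm_num
      have hsum : T * (N' : ℝ) ^ (12 / 5 : ℝ) + (N' : ℝ) ^ (18 / 5 : ℝ) ≤
          16 * (T * (N : ℝ) ^ (12 / 5 : ℝ) + (N : ℝ) ^ (18 / 5 : ℝ)) := by
        nlinarith [mul_le_mul_of_nonneg_left h12 hT0.le, h18,
          show 0 ≤ T * (N : ℝ) ^ (12 / 5 : ℝ) by positivity]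
      have hNε : (N' : ℝ) ^ (4 * Δ + δ) ≤ 2 * T ^ (ε' / 2) := by
        have e : 4 * Δ + δ = ε' / 2 := by rw [hΔ, hδ]; ring
        rw [e]
        have h1 : (N' : ℝ) ≤ 2 * T := by linarith
        calc (N' : ℝ) ^ (ε' / 2) ≤ (2 * T) ^ (ε' / 2) := Real.rpow_le_rpow hN'0.le h1 (by positivity)
          _ = (2 : ℝ) ^ (ε' / 2) * T ^ (ε' / 2) := Real.mul_rpow (by norm_num) hT0.le
          _ ≤ 2 * T ^ (ε' / 2) := by
              refine mul_le_mul_of_nonneg_right ?_ (by positivity)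
              calc (2 : ℝ) ^ (ε' / 2) ≤ (2 : ℝ) ^ (1 : ℝ) :=
                    Real.rpow_le_rpow_of_exponent_le (by norm_num) (by linarith)
                _ = 2 := Real.rpow_one _
      have hTT : T ^ η * T ^ (ε' / 2) ≤ T ^ ε' := by
        rw [← Real.rpow_add hT0, hη]
        exact Real.rpow_le_rpow_of_exponent_le hT1 (by linarith)
      have hpbpc : (T * (N : ℝ) ^ (12 / 5 : ℝ) + (N : ℝ) ^ (18 / 5 : ℝ)) * V⁻¹ ^ 4 = pb + pc := by
        rw [hpb, hpc']; ring
      calc (WP.card : ℝ) ≤ 81 * Cf j * (T ^ η + 2) *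
            ((T * (N' : ℝ) ^ (12 / 5 : ℝ) + (N' : ℝ) ^ (18 / 5 : ℝ)) * (N' : ℝ) ^ (4 * Δ + δ) * V⁻¹ ^ 4) := hpbd
        _ ≤ 81 * C_max * (3 * T ^ η) *
            ((16 * (T * (N : ℝ) ^ (12 / 5 : ℝ) + (N : ℝ) ^ (18 / 5 : ℝ))) * (2 * T ^ (ε' / 2)) * V⁻¹ ^ 4) := by
            gcongr
        _ = 7776 * C_max * (T ^ η * T ^ (ε' / 2)) *
            ((T * (N : ℝ) ^ (12 / 5 : ℝ) + (N : ℝ) ^ (18 / 5 : ℝ)) * V⁻¹ ^ 4) := by ring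
        _ ≤ 7776 * C_max * T ^ ε' *
            ((T * (N : ℝ) ^ (12 / 5 : ℝ) + (N : ℝ) ^ (18 / 5 : ℝ)) * V⁻¹ ^ 4) := by gcongr
        _ = 7776 * C_max * T ^ ε' * (pb + pc) := by rw [hpbpc]
    -- ### the three pieces and their parameters
    set P₁ := (Finset.Icc N (2 * N)).filter (fun n ↦ 5 * n < 6 * N) with hP₁
    set P₂ := (Finset.Icc N (2 * N)).filter (fun n ↦ 6 * N ≤ 5 * n ∧ 5 * n ≤ 9 * N) with hP₂
    set P₃ := (Finset.Icc N (2 * N)).filter (fun n ↦ 9 * N < 5 * n) with hP₃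
    have hP₁' : ∀ n ∈ P₁, 6 * (5 * N / 6) ≤ 5 * n ∧ 5 * n ≤ 9 * (5 * N / 6) := by
      intro n hn
      rw [hP₁, Finset.mem_filter, Finset.mem_Icc] at hn
      omega
    have hP₂' : ∀ n ∈ P₂, 6 * N ≤ 5 * n ∧ 5 * n ≤ 9 * N := by
      intro n hn
      rw [hP₂, Finset.mem_filter, Finset.mem_Icc] at hn
      omega
    have hP₃' : ∀ n ∈ P₃, 6 * ((10 * N + 8) / 9) ≤ 5 * n ∧ 5 * n ≤ 9 * ((10 * N + 8) / 9) := by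
      intro n hn
      rw [hP₃, Finset.mem_filter, Finset.mem_Icc] at hn
      omega
    have h1 := hpiece P₁ (5 * N / 6) hP₁' (by omega) (by omega)
    have h2 := hpiece P₂ N hP₂' (by omega) (by omega)
    have h3 := hpiece P₃ ((10 * N + 8) / 9) hP₃' (by omega) (by omega)
    -- the cover
    set W₁ := W.filter (fun t : ℝ ↦ V / 3 ≤ ‖∑ n ∈ P₁, b n * (n : ℂ) ^ ((t : ℂ) * I)‖) with hW₁
    set W₂ := W.filter (fun t : ℝ ↦ V / 3 ≤ ‖∑ n ∈ P₂, b n * (n : ℂ) ^ ((t : ℂ) * I)‖) with hW₂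
    set W₃ := W.filter (fun t : ℝ ↦ V / 3 ≤ ‖∑ n ∈ P₃, b n * (n : ℂ) ^ ((t : ℂ) * I)‖) with hW₃
    have hcover : W ⊆ W₁ ∪ W₂ ∪ W₃ := by
      intro t ht
      have hsplit := norm_sum_Icc_le_three_pieces N (fun n ↦ b n * (n : ℂ) ^ ((t : ℂ) * I))
      rw [← hP₁, ← hP₂, ← hP₃] at hsplit
      have hVt := hlarge t ht
      rw [Finset.mem_union, Finset.mem_union, hW₁, hW₂, hW₃, Finset.mem_filter, Finset.mem_filter,
        Finset.mem_filter]
      by_contra hcon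
      push Not at hcon
      obtain ⟨⟨h1', h2'⟩, h3'⟩ := hcon
      have := h1' ht; have := h2' ht; have := h3' ht
      linarith
    have htot : (W.card : ℝ) ≤ W₁.card + W₂.card + W₃.card := by
      have := (Finset.card_le_card hcover).trans
        ((Finset.card_union_le _ _).trans (Nat.add_le_add_right (Finset.card_union_le _ _) _))
      exact_mod_cast this
    refine hfinal hK₄0 (by linarith) (show pb + pc ≤ pa + pb + pc by linarith) ?_
    calc (W.card : ℝ) ≤ W₁.card + W₂.card + W₃.card := htot
      _ ≤ 7776 * C_max * T ^ ε' * (pb + pc) + 7776 * C_max * T ^ ε' * (pb + pc) +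
            7776 * C_max * T ^ ε' * (pb + pc) := add_le_add (add_le_add h1 h2) h3
      _ = K₄ * T ^ ε' * (pb + pc) := by rw [hK₄]; ring

end GuthMaynardReduction

/-- **`zeroDensity_guth_maynard` from Guth–Maynard's Proposition 3.1.** If Proposition 3.1 of
the paper holds for some weight `w` equal to `1` on `[6/5, 9/5]` (hypothesis `hKP`, the
proposition as printed, with its `o_ε(1)` read as "for every `δ > 0` and `N ≥ N₀(σ, ε, δ)`"),
then Theorem 1.1 holds (`GuthMaynardReduction.largeValues_of_keyProp`, §3 of the paper) and hence
the named fact `zeroDensity_guth_maynard` (Theorem 1.2 on `[7/10, 1]`,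
`zeroDensity_guth_maynard_of_largeValues`). What remains for an unconditional discharge of the
fact is exactly Proposition 3.1 (§§4–12 of the paper).
[cite: GuthMaynard2026, Proposition 3.1, Section 3, Theorems 1.1 and 1.2] -/
theorem zeroDensity_guth_maynard_of_keyProp {w : ℝ → ℝ}
    (hw : ∀ u : ℝ, 6 / 5 ≤ u → u ≤ 9 / 5 → w u = 1)
    (hKP : ∀ σ : ℝ, 7 / 10 ≤ σ → σ ≤ 4 / 5 → ∀ ε : ℝ, 0 < ε → ∀ δ : ℝ, 0 < δ →
      ∃ C N₀ : ℝ, ∀ N : ℕ, N₀ ≤ (N : ℝ) → ∀ (b : ℕ → ℂ) (t₀ : ℝ) (W : Finset ℝ),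
      (∀ n, ‖b n‖ ≤ 1) → (∀ t ∈ W, t₀ ≤ t ∧ t ≤ t₀ + (N : ℝ) ^ (6 / 5 : ℝ)) →
      (∀ t ∈ W, ∀ t' ∈ W, t ≠ t' → ((N : ℝ) ^ (6 / 5 : ℝ)) ^ ε ≤ |t - t'|) →
      (∀ t ∈ W, (N : ℝ) ^ σ ≤ ‖∑ n ∈ Finset.Icc N (2 * N), ((w ((n : ℝ) / N) : ℝ) : ℂ) * b n *
        (n : ℂ) ^ ((t : ℂ) * I)‖) →
      (W.card : ℝ) ≤ C * (N : ℝ) ^ (6 / 5 : ℝ) * (N : ℝ) ^ ((12 - 20 * σ) / 5 + δ)) :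
    zeroDensity_guth_maynard :=
  zeroDensity_guth_maynard_of_largeValues (GuthMaynardReduction.largeValues_of_keyProp hw hKP)

end Literature.NumberTheory.LFunctions

end
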